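import Literature.Analysis.FluidPDE.NSGaldiDualityIdentity
import Literature.Analysis.FluidPDE.KNSSLemma31Assembly
import Literature.Analysis.FluidPDE.ForwardMildWeak
import Literature.Analysis.FluidPDE.DriftMildBootstrap
import Mathlib.Analysis.Calculus.LineDeriv.IntegrationByParts
import Mathlib.Analysis.Calculus.BumpFunction.FiniteDimension
import HarnessLib

/-!
# Caloric duality for a weak forced heat identity with an initial datum

Analysis/FluidPDE support file (everything proved; no definitions, no named facts) on the proof
path of the named fact `Literature.Analysis.FluidPDE.jia_sverak_2014_local_higher_regularity`
(`JiaSverak2014LocalRegularity.lean`; H. Jia, V. Šverák, Invent. Math. 196 (2014) =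
arXiv:1204.0529, §4, proof of Thm. 4.1 with §3, proof of Thm. 3.2: the localised velocity
`ζu` of a Leray solution near the initial time is written through the heat kernel,
`u₁ = ∫₀ᵗ e^{Δ(t-s)}[-div(u ⊗ u η) - ∇(pη)] ds`, `u₂ = e^{Δt}(u₀η)`, arXiv p. 9). In the tree the
localised Navier–Stokes equations are first reduced to a **weak forced heat identity with an
initial datum** for a field `W` (`= ζu`) on the slab `(0, T) × E`:

  `(WH)` `∫∫_{(0,T)×E} (⟪W, ∂ₜΨ⟫ + ⟪W, ΔΨ⟫ + ⟪G₀, Ψ⟫ + Σⱼ ⟪G₁ j, ∂_{bⱼ}Ψ⟫) + ∫ ⟪W₀, Ψ(0)⟫ = 0`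

for every space–time test field `Ψ` on `(-∞, T) × E`, with data `G₀`, `G₁ j` (the commutator,
transport and pressure terms) and datum `W₀ = ζu₀`, all integrable on the slab and supported in
a fixed compact set in space. This file proves the **duality identity** that turns `(WH)` into a
representation of `W`: for every space–time test field `Θ` on `(-∞, T) × E`,

  `(D)` `∫∫_{(0,T)×E} ⟪W, Θ⟫ = ∫ ⟪W₀, 𝒰[Θ](0)⟫ + ∫∫_{(0,T)×E} (⟪G₀, 𝒰[Θ]⟫ + Σⱼ ⟪G₁ j, ∂_{bⱼ}𝒰[Θ]⟫)`

(`duality_identity_of_weakHeat`), where `𝒰[Θ](s) = ∫_{σ>0} e^{σΔ}Θ(s + σ) dσ` is the backward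
caloric Duhamel integral of the tree (`heatDuhamelBack 1 Θ`, `HeatDuhamelBack.lean`), the
solution of the adjoint problem `∂ₛ𝒰 + Δ𝒰 = -Θ`, `𝒰 = 0` after the time support of `Θ`. The
proof tests `(WH)` with `Ψ = (κ(s)χ(x)) • 𝒰[Θ](s)(x)`, `κ` a time cut-off equal to `1` on
`[-1, ∞)` and `χ` a space cut-off equal to `1` near the compact set carrying the data (so that
`Ψ` is compactly supported although `𝒰[Θ]` is not), and uses the backward heat equation; this is
the duality technique of the tree's `OseenDuhamelWeakStokes.lean` / `CaloricRepresentationNu.lean`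
(Lemarié-Rieusset 2016, Prop. 4.3 and §13.9), here with the initial datum kept. The passage from
`(D)` to forward heat potentials of the data (the terms `u₁`, `u₂` of Jia–Šverák) is the sequel
file.

## References

* H. Jia, V. Šverák, Invent. Math. 196 (2014) 233–265 = arXiv:1204.0529, §3 proof of Thm. 3.2
  (p. 9), §4 proof of Thm. 4.1. [JiaSverak2014]
* P. G. Lemarié-Rieusset, *The Navier–Stokes Problem in the 21st Century*, CRC Press 2016,
  Prop. 4.3 pp. 74–75 (the Duhamel integrals), §13.9 (13.50)–(13.52) (representation of the
  localised velocity through the heat kernel). [LemarieRieusset2016]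
-/

open MeasureTheory Filter Topology Set InnerProductSpace Metric Function TopologicalSpace
open scoped Real ENNReal NNReal Laplacian ContDiff RealInnerProductSpace

noncomputable section

namespace Literature.Analysis.FluidPDE

variable {E : Type*} [NormedAddCommGroup E] [InnerProductSpace ℝ E] [FiniteDimensional ℝ E]
  [MeasurableSpace E] [BorelSpace E]

/-! ### Time support of test fields on `(-∞, T) × E` -/

section TimeSupport

variable {F : Type*} [NormedAddCommGroup F] [NormedSpace ℝ F]

omit [InnerProductSpace ℝ E] [FiniteDimensional ℝ E] [MeasurableSpace E] [BorelSpace E] in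
/-- A space–time test field on the slab `(-∞, T) × E` has its time support in a compact interval
`[a, b]` with `b < T`. [folklore] -/
theorem IsSpaceTimeTestOn.exists_time_support_Iio [NormedSpace ℝ E] {T : ℝ} {ψ : ℝ → E → F}
    (hψ : IsSpaceTimeTestOn (slab E (Iio T) isOpen_Iio) ψ) :
    ∃ a b : ℝ, b < T ∧ ∀ t, t ∉ Icc a b → ψ t = 0 := by
  rcases (tsupport (uncurry ψ)).eq_empty_or_nonempty with h0 | hne
  · have hz : uncurry ψ = 0 := tsupport_eq_empty_iff.1 h0
    refine ⟨T - 1, T - 1, by linarith, fun t _ => funext fun x => ?_⟩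
    exact congrFun hz (t, x)
  · have hK : IsCompact (tsupport (uncurry ψ)) := hψ.hasCompactSupport
    obtain ⟨z₁, hz₁, hmax⟩ := hK.exists_isMaxOn hne continuous_fst.continuousOn
    obtain ⟨z₀, hz₀, hmin⟩ := hK.exists_isMinOn hne continuous_fst.continuousOn
    have hb : z₁.1 < T := mem_slab.1 (hψ.tsupport_subset hz₁)
    refine ⟨z₀.1, z₁.1, hb, fun t ht => funext fun x => ?_⟩
    by_contra hne'
    have hmem : (t, x) ∈ tsupport (uncurry ψ) := subset_tsupport _ (by simpa using hne')
    exact ht ⟨hmin hmem, hmax hmem⟩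

end TimeSupport

/-! ### The cut-off adjoint test field `Ψ = (κ χ) • 𝒰[Θ]` -/

section TestField

variable {T : ℝ} {Θ : ℝ → E → E}

/-- **The cut-off adjoint field is a space–time test field on `(-∞, T) × E`.** For a space–time
test field `Θ` on `(-∞, T) × E`, the time cut-off `κ` and a bump `χ`, the field
`Ψ(s, x) = (κ(s) χ(x)) • 𝒰[Θ](s)(x)` is smooth, compactly supported (time support in `[-2, b]`,
`b < T` the end of the time support of `Θ`, after which `𝒰[Θ]` vanishes; space support in that
of `χ`) and supported in `(-∞, T) × E`. [folklore] -/
theorem isSpaceTimeTestOn_cutoff_smul_heatDuhamelBack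
    (hΘ : IsSpaceTimeTestOn (slab E (Iio T) isOpen_Iio) Θ) (χ : ContDiffBump (0 : E)) :
    IsSpaceTimeTestOn (slab E (Iio T) isOpen_Iio)
      (fun s x => (Real.smoothTransition (s + 2) * χ x) • heatDuhamelBack 1 Θ s x) := by
  have hΘ' : IsSpaceTimeTestOn (⊤ : Opens (ℝ × E)) Θ := hΘ.mono le_top
  obtain ⟨a, b, hbT, hab⟩ := hΘ.exists_time_support_Iio
  obtain ⟨hκ, -, hκ0⟩ := timeCutoff_props
  set Ψ : ℝ → E → E := fun s x => (Real.smoothTransition (s + 2) * χ x) • heatDuhamelBack 1 Θ s x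
    with hΨ
  -- the compact set carrying `Ψ`
  set K : Set (ℝ × E) := Icc (-2 : ℝ) b ×ˢ closedBall (0 : E) χ.rOut with hK
  have hKc : IsCompact K := isCompact_Icc.prod (isCompact_closedBall _ _)
  have hzero : ∀ z : ℝ × E, z ∉ K → uncurry Ψ z = 0 := by
    rintro ⟨s, x⟩ hz
    simp only [uncurry_apply_pair, hΨ]
    by_cases hs : s ∈ Icc (-2 : ℝ) b
    · have hx : x ∉ closedBall (0 : E) χ.rOut := fun hx => hz ⟨hs, hx⟩
      have hχ : χ x = 0 := by
        have : x ∉ Function.support χ := by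
          rw [χ.support_eq]; exact fun h => hx (ball_subset_closedBall h)
        simpa [Function.mem_support] using this
      rw [hχ, mul_zero, zero_smul]
    · rcases lt_or_ge s (-2) with h | h
      · rw [hκ0 s h.le, zero_mul, zero_smul]
      · have hbs : b ≤ s := by
          by_contra hbs; exact hs ⟨h, (not_le.1 hbs).le⟩
        rw [hΘ'.heatDuhamelBack_eq_zero_of_le one_pos hab hbs x, smul_zero]
  refine ⟨?_, HasCompactSupport.intro hKc hzero, ?_⟩
  · exact hΘ'.contDiff_uncurry_smul_heatDuhamelBack one_pos hκ χ.contDiff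
  · -- `tsupport ⊆ K ⊆ (-∞, T) × E`
    intro z hz
    have hzK : z ∈ K := by
      have hcl : tsupport (uncurry Ψ) ⊆ K :=
        closure_minimal (fun w hw => by_contra fun h => hw (hzero w h)) hKc.isClosed
      exact hcl hz
    exact mem_slab.2 (lt_of_le_of_lt hzK.1.2 hbT)

end TestField

/-! ### The duality identity -/

section Duality

variable {ι : Type*} [Fintype ι] {T : ℝ} {W : ℝ → E → E} {W₀ : E → E} {G₀ : ℝ → E → E}
  {G₁ : ι → ℝ → E → E} {b : ι → E} {K : Set E}

/-- **Caloric duality for the weak forced heat identity with datum.** Let `W, G₀, G₁ j` be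
integrable on the slab `(0, T) × E` and vanish for `x` outside a compact set `K`, let `W₀` be
integrable and vanish outside `K`, and suppose the weak identity `(WH)`
`∫∫_{(0,T)×E} (⟪W, ∂ₜΨ⟫ + ⟪W, ΔΨ⟫ + ⟪G₀, Ψ⟫ + Σⱼ ⟪G₁ j, ∂_{bⱼ}Ψ⟫) + ∫ ⟪W₀, Ψ(0)⟫ = 0` holds for
every space–time test field `Ψ` on `(-∞, T) × E`. Then for every space–time test field `Θ` on
`(-∞, T) × E`, with `𝒰 = heatDuhamelBack 1 Θ`,
`∫∫_{(0,T)×E} ⟪W, Θ⟫ = ∫ ⟪W₀, 𝒰(0)⟫ + ∫∫_{(0,T)×E} (⟪G₀, 𝒰⟫ + Σⱼ ⟪G₁ j, ∂_{bⱼ}𝒰⟫)`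
(test `(WH)` with `(κχ) • 𝒰`, `κ = 1` on `[-1, ∞)`, `χ = 1` near `K`; on `(0,T) × K` the field is
`𝒰`, whose backward heat equation `∂ₛ𝒰 + Δ𝒰 = -Θ` produces the left-hand side).
(Lemarié-Rieusset 2016, Prop. 4.3 and §13.9; the datum-carrying form of the duality of the
tree's `OseenDuhamelWeakStokes.lean`.) [cite: LemarieRieusset2016, Prop. 4.3 pp. 74–75 and §13.9 (13.50)–(13.52)] -/
theorem duality_identity_of_weakHeat (hT : 0 < T) (hKc : IsCompact K)
    (hW : Integrable (uncurry W) (volume.restrict (Ioo 0 T ×ˢ (univ : Set E))))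
    (hG₀ : Integrable (uncurry G₀) (volume.restrict (Ioo 0 T ×ˢ (univ : Set E))))
    (hG₁ : ∀ j, Integrable (uncurry (G₁ j)) (volume.restrict (Ioo 0 T ×ˢ (univ : Set E))))
    (hWK : ∀ t x, x ∉ K → W t x = 0) (hG₀K : ∀ t x, x ∉ K → G₀ t x = 0)
    (hG₁K : ∀ j t x, x ∉ K → G₁ j t x = 0) (hW₀K : ∀ x, x ∉ K → W₀ x = 0)
    (hWH : ∀ Ψ : ℝ → E → E, IsSpaceTimeTestOn (slab E (Iio T) isOpen_Iio) Ψ →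
      (∫ z in Ioo 0 T ×ˢ (univ : Set E), (⟪W z.1 z.2, timeDeriv Ψ z.1 z.2⟫ +
        ⟪W z.1 z.2, Δ (Ψ z.1) z.2⟫ + ⟪G₀ z.1 z.2, Ψ z.1 z.2⟫ +
        ∑ j, ⟪G₁ j z.1 z.2, fderiv ℝ (Ψ z.1) z.2 (b j)⟫)) + ∫ x, ⟪W₀ x, Ψ 0 x⟫ = 0)
    {Θ : ℝ → E → E} (hΘ : IsSpaceTimeTestOn (slab E (Iio T) isOpen_Iio) Θ) :
    ∫ z in Ioo 0 T ×ˢ (univ : Set E), ⟪W z.1 z.2, Θ z.1 z.2⟫ =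
      (∫ x, ⟪W₀ x, heatDuhamelBack 1 Θ 0 x⟫) +
      ∫ z in Ioo 0 T ×ˢ (univ : Set E), (⟪G₀ z.1 z.2, heatDuhamelBack 1 Θ z.1 z.2⟫ +
        ∑ j, ⟪G₁ j z.1 z.2, fderiv ℝ (heatDuhamelBack 1 Θ z.1) z.2 (b j)⟫) := by
  have hΘ' : IsSpaceTimeTestOn (⊤ : Opens (ℝ × E)) Θ := hΘ.mono le_top
  obtain ⟨a, b', hbT, hab⟩ := hΘ.exists_time_support_Iio
  obtain ⟨hκ, hκ1, hκ0⟩ := timeCutoff_props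
  -- the space cut-off `χ = 1` near `K`
  obtain ⟨R, hR⟩ := hKc.isBounded.subset_closedBall (0 : E)
  let χ : ContDiffBump (0 : E) := ⟨|R| + 1, |R| + 2, by positivity, by linarith⟩
  have hχK : ∀ x ∈ K, (χ : E → ℝ) =ᶠ[𝓝 x] 1 := fun x hx => by
    refine χ.eventuallyEq_one_of_mem_ball ?_
    have : x ∈ closedBall (0 : E) R := hR hx
    rw [mem_closedBall] at this
    rw [mem_ball]
    show dist x 0 < |R| + 1
    linarith [le_abs_self R]
  have hχK1 : ∀ x ∈ K, χ x = 1 := fun x hx => (hχK x hx).self_of_nhds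
  -- the test field and the weak identity tested with it
  set 𝒰 : ℝ → E → E := heatDuhamelBack 1 Θ with h𝒰
  set Ψ : ℝ → E → E := fun s x => (Real.smoothTransition (s + 2) * χ x) • 𝒰 s x with hΨ
  have hΨtest : IsSpaceTimeTestOn (slab E (Iio T) isOpen_Iio) Ψ :=
    isSpaceTimeTestOn_cutoff_smul_heatDuhamelBack hΘ χ
  have hmain := hWH Ψ hΨtest
  -- (1) the slices of `Ψ` at positive times, near points of `K`
  have hΨpos : ∀ s : ℝ, 0 < s → Ψ s = fun x => χ x • 𝒰 s x := fun s hs => by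
    funext x; simp only [hΨ]; rw [hκ1 s (by linarith), one_mul]
  have hΨnhds : ∀ s : ℝ, 0 < s → ∀ x ∈ K, Ψ s =ᶠ[𝓝 x] 𝒰 s := fun s hs x hx => by
    rw [hΨpos s hs]
    filter_upwards [hχK x hx] with y hy
    rw [hy, Pi.one_apply, one_smul]
  -- time derivative at positive times: `∂ₛΨ(s, x) = χ(x) • 𝒰[∂ₜΘ](s)(x)`
  have htime : ∀ s : ℝ, 0 < s → ∀ x, timeDeriv Ψ s x =
      χ x • heatDuhamelBack 1 (timeDeriv Θ) s x := fun s hs x => by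
    rw [timeDeriv_apply]
    have hev : (fun s' => Ψ s' x) =ᶠ[𝓝 s] fun s' => χ x • 𝒰 s' x := by
      filter_upwards [Ioi_mem_nhds hs] with s' hs'
      have hs'' : 0 < s' := hs'
      simp only [hΨ]; rw [hκ1 s' (by linarith), one_mul]
    rw [hev.deriv_eq]
    have hd := hΘ'.hasDerivAt_heatDuhamelBack_time one_pos s x
    rw [h𝒰]
    exact (hd.const_smul (χ x)).deriv
  -- Laplacian and directional derivatives at positive times on `K`
  have hlap : ∀ s : ℝ, 0 < s → ∀ x ∈ K, Δ (Ψ s) x = heatDuhamelBack 1 (fun t => Δ (Θ t)) s x :=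
    fun s hs x hx => by
    rw [(laplacian_congr_nhds (hΨnhds s hs x hx)).self_of_nhds, h𝒰,
      hΘ'.laplacian_heatDuhamelBack one_pos s x]
  have hder : ∀ s : ℝ, 0 < s → ∀ x ∈ K, ∀ v, fderiv ℝ (Ψ s) x v = fderiv ℝ (𝒰 s) x v :=
    fun s hs x hx v => by rw [(hΨnhds s hs x hx).fderiv_eq]
  -- (2) the integrand of `(WH)` on the slab, pointwise
  set A : ℝ × E → ℝ := fun z => ⟪W z.1 z.2, Θ z.1 z.2⟫ with hA
  set B : ℝ × E → ℝ := fun z => ⟪G₀ z.1 z.2, 𝒰 z.1 z.2⟫ +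
    ∑ j, ⟪G₁ j z.1 z.2, fderiv ℝ (𝒰 z.1) z.2 (b j)⟫ with hB
  have hpt : ∀ z ∈ Ioo 0 T ×ˢ (univ : Set E),
      (⟪W z.1 z.2, timeDeriv Ψ z.1 z.2⟫ + ⟪W z.1 z.2, Δ (Ψ z.1) z.2⟫ + ⟪G₀ z.1 z.2, Ψ z.1 z.2⟫ +
        ∑ j, ⟪G₁ j z.1 z.2, fderiv ℝ (Ψ z.1) z.2 (b j)⟫) = -A z + B z := by
    rintro ⟨s, x⟩ ⟨hs, -⟩
    simp only [hA, hB]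
    by_cases hx : x ∈ K
    · -- on `K`: the backward heat equation
      have hbh := hΘ'.heatDuhamelBack_backward_heat one_pos s x
      rw [one_smul] at hbh
      have e1 : Ψ s x = 𝒰 s x := by
        rw [hΨpos s hs.1]; dsimp only; rw [hχK1 x hx, one_smul]
      have e2 : ∀ j, fderiv ℝ (Ψ s) x (b j) = fderiv ℝ (𝒰 s) x (b j) := fun j => hder s hs.1 x hx (b j)
      rw [htime s hs.1 x, hχK1 x hx, one_smul, hlap s hs.1 x hx, ← inner_add_right, hbh,
        inner_neg_right, e1]
      simp_rw [e2]
      ring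
    · -- off `K`: everything vanishes
      simp [hWK s x hx, hG₀K s x hx, hG₁K _ s x hx]
  -- (3) integrability of `A` and `B` on the slab
  obtain ⟨MΘ, hMΘ0, hMΘ⟩ := hΘ'.exists_norm_le
  have hΘc : Continuous (uncurry Θ) := hΘ'.continuous_uncurry
  have hAi : Integrable A (volume.restrict (Ioo 0 T ×ˢ (univ : Set E))) := by
    refine (hW.norm.mul_const MΘ).mono' (hW.1.inner hΘc.aestronglyMeasurable) ?_
    exact Eventually.of_forall fun z => (norm_inner_le_norm _ _).trans
      (mul_le_mul_of_nonneg_left (hMΘ z.1 z.2) (norm_nonneg _))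
  -- bounds and continuity of `𝒰` and `∂_v 𝒰`
  have h𝒰c : Continuous (uncurry 𝒰) := hΘ'.continuous_heatDuhamelBack one_pos
  have h𝒰b : ∀ s x, ‖𝒰 s x‖ ≤ MΘ * (|b'| + 2 + |s|) := fun s x => by
    refine (hΘ'.norm_heatDuhamelBack_le one_pos hMΘ hab s x).trans ?_
    refine mul_le_mul_of_nonneg_left ?_ hMΘ0
    refine max_le ?_ (by positivity)
    linarith [le_abs_self b', neg_abs_le s]
  have hΘv : ∀ v, IsSpaceTimeTestOn (⊤ : Opens (ℝ × E)) (fun t y => fderiv ℝ (Θ t) y v) :=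
    fun v => hΘ'.fderiv_apply_top v
  have hder𝒰 : ∀ v s x, fderiv ℝ (𝒰 s) x v = heatDuhamelBack 1 (fun t y => fderiv ℝ (Θ t) y v) s x :=
    fun v s x => hΘ'.fderiv_heatDuhamelBack_apply one_pos s x v
  have hBi : Integrable B (volume.restrict (Ioo 0 T ×ˢ (univ : Set E))) := by
    have hslab_s : ∀ᵐ z ∂(volume.restrict (Ioo 0 T ×ˢ (univ : Set E))), z.1 ∈ Ioo 0 T := by
      filter_upwards [ae_restrict_mem (measurableSet_Ioo.prod MeasurableSet.univ)] with z hz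
      exact hz.1
    -- the `G₀` term
    have h0 : Integrable (fun z : ℝ × E => ⟪G₀ z.1 z.2, 𝒰 z.1 z.2⟫)
        (volume.restrict (Ioo 0 T ×ˢ (univ : Set E))) := by
      refine (hG₀.norm.mul_const (MΘ * (|b'| + 2 + |T|))).mono'
        (hG₀.1.inner h𝒰c.aestronglyMeasurable) ?_
      filter_upwards [hslab_s] with z hz
      refine (norm_inner_le_norm _ _).trans (mul_le_mul_of_nonneg_left ?_ (norm_nonneg _))
      refine (h𝒰b z.1 z.2).trans (mul_le_mul_of_nonneg_left ?_ hMΘ0)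
      have : |z.1| ≤ |T| := by
        rw [abs_of_pos hz.1]; exact hz.2.le.trans (le_abs_self T)
      linarith
    -- the `G₁` terms
    have h1 : ∀ j, Integrable (fun z : ℝ × E => ⟪G₁ j z.1 z.2, fderiv ℝ (𝒰 z.1) z.2 (b j)⟫)
        (volume.restrict (Ioo 0 T ×ˢ (univ : Set E))) := fun j => by
      obtain ⟨Mv, hMv0, hMv⟩ := (hΘv (b j)).exists_norm_le
      have habv : ∀ t, t ∉ Icc a b' → (fun y => fderiv ℝ (Θ t) y (b j)) = 0 := fun t ht => by
        funext y; rw [hab t ht]; simp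
      have hcont : Continuous (uncurry fun s x => fderiv ℝ (𝒰 s) x (b j)) := by
        have := (hΘv (b j)).continuous_heatDuhamelBack one_pos
        refine this.congr fun z => ?_
        simp only [uncurry]; rw [hder𝒰]
      refine ((hG₁ j).norm.mul_const (Mv * (|b'| + 2 + |T|))).mono'
        ((hG₁ j).1.inner hcont.aestronglyMeasurable) ?_
      filter_upwards [hslab_s] with z hz
      refine (norm_inner_le_norm _ _).trans (mul_le_mul_of_nonneg_left ?_ (norm_nonneg _))
      rw [hder𝒰]
      refine ((hΘv (b j)).norm_heatDuhamelBack_le one_pos hMv habv z.1 z.2).trans ?_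
      refine mul_le_mul_of_nonneg_left ?_ hMv0
      have : |z.1| ≤ |T| := by
        rw [abs_of_pos hz.1]; exact hz.2.le.trans (le_abs_self T)
      refine max_le ?_ (by positivity)
      linarith [le_abs_self b', neg_abs_le z.1, abs_nonneg z.1]
    have hBeq : B = (fun z : ℝ × E => ⟪G₀ z.1 z.2, 𝒰 z.1 z.2⟫) +
        fun z : ℝ × E => ∑ j, ⟪G₁ j z.1 z.2, fderiv ℝ (𝒰 z.1) z.2 (b j)⟫ := by
      funext z; simp only [hB, Pi.add_apply]
    rw [hBeq]
    exact h0.add (integrable_finsetSum _ fun j _ => h1 j)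
  -- (4) the datum term: `Ψ(0) = χ • 𝒰(0)`, and `χ = 1` on `K`
  have hdatum : ∫ x, ⟪W₀ x, Ψ 0 x⟫ = ∫ x, ⟪W₀ x, 𝒰 0 x⟫ := by
    refine integral_congr_ae (Eventually.of_forall fun x => ?_)
    by_cases hx : x ∈ K
    · simp only [hΨ]; rw [hκ1 0 (by norm_num), one_mul, hχK1 x hx, one_smul]
    · simp [hW₀K x hx]
  -- (5) assemble
  have hsplit : ∫ z in Ioo 0 T ×ˢ (univ : Set E), (⟪W z.1 z.2, timeDeriv Ψ z.1 z.2⟫ +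
      ⟪W z.1 z.2, Δ (Ψ z.1) z.2⟫ + ⟪G₀ z.1 z.2, Ψ z.1 z.2⟫ +
      ∑ j, ⟪G₁ j z.1 z.2, fderiv ℝ (Ψ z.1) z.2 (b j)⟫) =
      -(∫ z in Ioo 0 T ×ˢ (univ : Set E), A z) + ∫ z in Ioo 0 T ×ˢ (univ : Set E), B z := by
    have hAn : Integrable (fun z => -A z) (volume.restrict (Ioo 0 T ×ˢ (univ : Set E))) := hAi.neg
    rw [setIntegral_congr_fun (measurableSet_Ioo.prod MeasurableSet.univ) hpt,
      integral_add hAn hBi, integral_neg]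
  rw [hsplit, hdatum] at hmain
  simp only [hA, hB] at hmain
  linarith

end Duality

/-! ### Joint measurability of caloric lifts -/

section Measurability

/-- The diagonal lift `(σ, x) ↦ e^{σΔ}z(σ)(x)` of a jointly measurable field is jointly
measurable. [folklore] -/
theorem measurable_heatExtension_diag {z : ℝ → E → E} (hzm : Measurable (uncurry z)) :
    Measurable fun q : ℝ × E => UnboundedOperators.heatExtension (z q.1) q.1 q.2 := by
  have hg : Measurable fun q : ℝ × E => ((q.1, q.1, q.2) : ℝ × ℝ × E) :=
    measurable_fst.prodMk (measurable_fst.prodMk measurable_snd)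
  change Measurable ((fun p : ℝ × ℝ × E => UnboundedOperators.heatExtension (z p.1) p.2.1 p.2.2) ∘
    fun q : ℝ × E => ((q.1, q.1, q.2) : ℝ × ℝ × E))
  exact (measurable_heatExtension_slice hzm).comp hg

end Measurability

/-! ### The datum term: `∫ ⟪W₀, 𝒰[Θ](0)⟫ = ∫∫ ⟪e^{tΔ}W₀, Θ⟫` -/

section Datum

/-- The slab measure is the product of the restricted time measure and the space measure. [folklore] -/
theorem volume_restrict_Ioo_prod_univ (T : ℝ) :
    (volume : Measure (ℝ × E)).restrict (Ioo 0 T ×ˢ univ) =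
      ((volume : Measure ℝ).restrict (Ioo 0 T)).prod (volume : Measure E) := by
  rw [Measure.volume_eq_prod, Measure.restrict_prod_eq_prod_univ]

/-- **The datum term of the duality identity as a slab pairing with the free flow**: for a
bounded measurable integrable datum `W₀` and a space–time test field `Θ` on `(0, T) × E`,
`∫ ⟪W₀, 𝒰[Θ](0)⟫ = ∫∫_{(0,T)×E} ⟪e^{tΔ}W₀, Θ⟫` (the inner product passes inside the Duhamel
integral, Fubini in `(x, σ)`, symmetry of the heat semigroup on each slice, and `Θ(σ) = 0` for
`σ ∉ (0, T)`). [folklore] -/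
theorem integral_inner_heatDuhamelBack_zero_eq {W₀ : E → E} (hW₀m : Measurable W₀)
    {M : ℝ} (hW₀b : ∀ x, ‖W₀ x‖ ≤ M) (hW₀i : Integrable W₀ volume) {T : ℝ} (hT : 0 < T)
    {Θ : ℝ → E → E} (hΘ : IsSpaceTimeTestOn (slab E (Ioo 0 T) isOpen_Ioo) Θ) :
    ∫ x, ⟪W₀ x, heatDuhamelBack 1 Θ 0 x⟫ =
      ∫ z in Ioo 0 T ×ˢ (univ : Set E), ⟪UnboundedOperators.heatExtension W₀ z.1 z.2, Θ z.1 z.2⟫ := by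
  have hΘ' : IsSpaceTimeTestOn (⊤ : Opens (ℝ × E)) Θ := hΘ.mono le_top
  obtain ⟨a, b', ha0, hab', hbT, hab⟩ := hΘ.exists_time_support_Ioo hT
  obtain ⟨MΘ, hMΘ0, hMΘ⟩ := hΘ'.exists_norm_le
  have hM0 : 0 ≤ M := (norm_nonneg _).trans (hW₀b 0)
  have hW₀top : MemLp W₀ ∞ (volume : Measure E) :=
    memLp_top_of_bound hW₀m.aestronglyMeasurable M (Eventually.of_forall hW₀b)
  -- the Duhamel integrand at base time `0`
  set F : ℝ → E → E := fun σ x => UnboundedOperators.heatExtension (Θ σ) σ x with hF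
  have hUF : ∀ x, heatDuhamelBack 1 Θ 0 x = ∫ σ in Ioi (0 : ℝ), F σ x := fun x => by
    rw [heatDuhamelBack_apply]
    refine setIntegral_congr_fun measurableSet_Ioi fun σ _ => ?_
    simp only [hF, zero_add, one_mul]
  have hFi : ∀ x, IntegrableOn (fun σ => F σ x) (Ioi 0) volume := fun x => by
    have h := hΘ'.integrableOn_duhamelIntegrand one_pos 0 x
    refine h.congr_fun (fun σ _ => ?_) measurableSet_Ioi
    simp only [hF, zero_add, one_mul]
  have hFzero : ∀ σ, σ ∉ Icc a b' → ∀ x, F σ x = 0 := fun σ hσ x => by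
    simp only [hF]; rw [hab σ hσ]
    exact congrFun (UnboundedOperators.heatExtension_zero_fun σ) x
  have hFb : ∀ σ, 0 < σ → ∀ x, ‖F σ x‖ ≤ MΘ := fun σ hσ x =>
    UnboundedOperators.norm_heatExtension_le (hMΘ σ) hσ x
  -- (1) the inner product passes inside the `σ`-integral
  have h1 : ∀ x, ⟪W₀ x, heatDuhamelBack 1 Θ 0 x⟫ = ∫ σ in Ioi (0 : ℝ), ⟪W₀ x, F σ x⟫ := fun x => by
    rw [hUF x, ← integral_inner (hFi x)]
  simp_rw [h1]
  -- (2) Fubini in `(x, σ)`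
  have hmeasF : Measurable fun q : ℝ × E => F q.1 q.2 :=
    measurable_heatExtension_diag hΘ'.contDiff.continuous.measurable
  have hint : Integrable (uncurry fun x σ => ⟪W₀ x, F σ x⟫)
      ((volume : Measure E).prod ((volume : Measure ℝ).restrict (Ioi 0))) := by
    have hm : AEStronglyMeasurable (uncurry fun x σ => ⟪W₀ x, F σ x⟫)
        ((volume : Measure E).prod ((volume : Measure ℝ).restrict (Ioi 0))) := by
      refine (hW₀m.aestronglyMeasurable.comp_fst).inner ?_
      exact (hmeasF.comp (measurable_snd.prodMk measurable_fst)).aestronglyMeasurable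
    have hind : Integrable ((Icc a b').indicator fun _ : ℝ => MΘ) (volume : Measure ℝ) :=
      (integrableOn_const (C := MΘ) (measure_Icc_lt_top (a := a) (b := b')).ne).integrable_indicator
        measurableSet_Icc
    refine Integrable.mono' ((hW₀i.norm).mul_prod (hind.mono_measure Measure.restrict_le_self)) hm ?_
    refine Eventually.of_forall fun q => ?_
    rcases q with ⟨x, σ⟩
    simp only [uncurry_apply_pair]
    refine (norm_inner_le_norm _ _).trans ?_
    by_cases hσ : σ ∈ Icc a b'
    · rw [indicator_of_mem hσ]
      exact mul_le_mul_of_nonneg_left (hFb σ (lt_of_lt_of_le ha0 hσ.1) x) (norm_nonneg _)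
    · rw [hFzero σ hσ x, norm_zero, mul_zero, indicator_of_notMem hσ, mul_zero]
  rw [integral_integral_swap hint]
  -- (3) symmetry of the heat semigroup on each slice `σ > 0`
  have h3 : ∀ σ ∈ Ioi (0 : ℝ), ∫ x, ⟪W₀ x, F σ x⟫ =
      ∫ x, ⟪UnboundedOperators.heatExtension W₀ σ x, Θ σ x⟫ := fun σ hσ => by
    haveI : ENNReal.HolderConjugate (∞ : ℝ≥0∞) 1 := ENNReal.HolderConjugate.symm
    have hΘσ : MemLp (Θ σ) 1 (volume : Measure E) :=
      memLp_one_iff_integrable.2 ((hΘ'.contDiff_slice σ).continuous.integrable_of_hasCompactSupport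
        (hΘ'.hasCompactSupport_slice σ))
    exact integral_inner_heatExtension_comm (p := ∞) (q := 1) hW₀top hΘσ hσ
  rw [setIntegral_congr_fun measurableSet_Ioi h3]
  -- (4) restrict to `(0, T)` and pass to the slab
  have hsub : Ioo 0 T ⊆ Ioi (0 : ℝ) := fun σ hσ => hσ.1
  rw [setIntegral_eq_of_subset_of_forall_sdiff_eq_zero measurableSet_Ioi hsub (fun σ hσ => by
    have hσ' : σ ∉ Icc a b' := fun h => hσ.2 ⟨(hσ.1 : 0 < σ), lt_of_le_of_lt h.2 hbT⟩
    simp [hab σ hσ'])]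
  -- iterated → product
  have hmW : Measurable fun q : ℝ × E => UnboundedOperators.heatExtension W₀ q.1 q.2 := by
    have hg : Measurable fun q : ℝ × E => (((0 : ℝ), q.1, q.2) : ℝ × ℝ × E) :=
      measurable_const.prodMk (measurable_fst.prodMk measurable_snd)
    change Measurable ((fun p : ℝ × ℝ × E =>
      UnboundedOperators.heatExtension ((fun _ : ℝ => W₀) p.1) p.2.1 p.2.2) ∘
        fun q : ℝ × E => (((0 : ℝ), q.1, q.2) : ℝ × ℝ × E))
    exact (measurable_heatExtension_slice (z := fun _ : ℝ => W₀) (hW₀m.comp measurable_snd)).comp hg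
  have hint2 : Integrable (fun z : ℝ × E => ⟪UnboundedOperators.heatExtension W₀ z.1 z.2, Θ z.1 z.2⟫)
      (((volume : Measure ℝ).restrict (Ioo 0 T)).prod (volume : Measure E)) := by
    have hm : AEStronglyMeasurable
        (fun z : ℝ × E => ⟪UnboundedOperators.heatExtension W₀ z.1 z.2, Θ z.1 z.2⟫)
        (((volume : Measure ℝ).restrict (Ioo 0 T)).prod (volume : Measure E)) :=
      hmW.aestronglyMeasurable.inner hΘ'.contDiff.continuous.aestronglyMeasurable
    have hΘi : Integrable (uncurry Θ) ((volume : Measure ℝ).prod (volume : Measure E)) :=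
      hΘ'.contDiff.continuous.integrable_of_hasCompactSupport hΘ'.hasCompactSupport
    refine Integrable.mono' ((hΘi.norm.const_mul M).mono_measure
      (Measure.prod_mono Measure.restrict_le_self le_rfl)) hm ?_
    have hI : ∀ᵐ z ∂(((volume : Measure ℝ).restrict (Ioo 0 T)).prod (volume : Measure E)), z.1 ∈ Ioo 0 T :=
      (Measure.quasiMeasurePreserving_fst (μ := (volume : Measure ℝ).restrict (Ioo 0 T))
        (ν := (volume : Measure E))).ae (ae_restrict_mem measurableSet_Ioo)
    filter_upwards [hI] with z hz
    refine (norm_inner_le_norm _ _).trans ?_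
    have h := UnboundedOperators.norm_heatExtension_le hW₀b hz.1 z.2
    calc ‖UnboundedOperators.heatExtension W₀ z.1 z.2‖ * ‖Θ z.1 z.2‖ ≤ M * ‖Θ z.1 z.2‖ :=
          mul_le_mul_of_nonneg_right h (norm_nonneg _)
      _ = M * ‖uncurry Θ z‖ := rfl
  rw [volume_restrict_Ioo_prod_univ, integral_prod _ hint2]

end Datum

/-! ### Triple integrals on `ℝ × ℝ × E` -/

section Triple

/-- **Swapping the two time integrals of an integrable function on `ℝ × ℝ × E`**:
`∫_s ∫_t ∫_x Φ(s, t, x) = ∫_t ∫_s ∫_x Φ(s, t, x)` (Fubini on `ℝ × ℝ` for the integrable function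
`(s, t) ↦ ∫_x Φ(s, t, x)`, obtained from `Φ` through the associativity equivalence
`(ℝ × ℝ) × E ≃ ℝ × (ℝ × E)`). [folklore] -/
theorem integral_integral_integral_swap_time {Φ : ℝ × ℝ × E → ℝ}
    (hΦ : Integrable Φ (volume : Measure (ℝ × ℝ × E))) :
    ∫ s : ℝ, ∫ t : ℝ, ∫ x : E, Φ (s, t, x) = ∫ t : ℝ, ∫ s : ℝ, ∫ x : E, Φ (s, t, x) := by
  have hA : Integrable (Φ ∘ (MeasurableEquiv.prodAssoc : (ℝ × ℝ) × E ≃ᵐ ℝ × ℝ × E))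
      (volume : Measure ((ℝ × ℝ) × E)) :=
    (volume_preserving_prodAssoc (α₁ := ℝ) (β₁ := ℝ) (γ₁ := E)).integrable_comp_of_integrable hΦ
  have hh : Integrable (fun q : ℝ × ℝ => ∫ x : E, Φ (q.1, q.2, x)) (volume : Measure (ℝ × ℝ)) := by
    have := hA.integral_prod_left
    refine this.congr (Eventually.of_forall fun q => ?_)
    rfl
  exact integral_integral_swap (f := fun s t => ∫ x : E, Φ (s, t, x)) hh

/-- `∫ p, Φ p = ∫_s ∫_{(t,x)} Φ (s, (t, x))` and the inner integral splits for a.e. `s`: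
`∫ p, Φ p = ∫_s ∫_t ∫_x Φ (s, t, x)` for integrable `Φ` on `ℝ × ℝ × E`. [folklore] -/
theorem integral_eq_integral_integral_integral {Φ : ℝ × ℝ × E → ℝ}
    (hΦ : Integrable Φ (volume : Measure (ℝ × ℝ × E))) :
    ∫ p, Φ p = ∫ s : ℝ, ∫ t : ℝ, ∫ x : E, Φ (s, t, x) := by
  rw [Measure.volume_eq_prod, integral_prod Φ hΦ]
  refine integral_congr_ae ?_
  filter_upwards [hΦ.prod_right_ae] with s hs
  rw [Measure.volume_eq_prod] at hs
  rw [Measure.volume_eq_prod, integral_prod _ hs]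

/-- `∫ p, Φ p = ∫_{(t,x)} ∫_s Φ (s, (t, x))` for integrable `Φ` on `ℝ × ℝ × E` (the swapped
product). [folklore] -/
theorem integral_eq_integral_integral_swap {Φ : ℝ × ℝ × E → ℝ}
    (hΦ : Integrable Φ (volume : Measure (ℝ × ℝ × E))) :
    ∫ p, Φ p = ∫ z : ℝ × E, ∫ s : ℝ, Φ (s, z) := by
  rw [Measure.volume_eq_prod, integral_prod_symm Φ hΦ]

end Triple

/-! ### The forcing term: `∫∫ ⟪G, 𝒰[Θ]⟫ = ∫∫ ⟪∫₀ᵗ e^{(t-s)Δ}G(s) ds, Θ⟫` -/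

section Forcing

variable {G : ℝ → E → E} {M : ℝ} {K : Set E} {T : ℝ} {Θ : ℝ → E → E}

/-- Slices of a bounded jointly measurable field vanishing off a compact set are in `L^∞` and
`L¹`. [folklore] -/
theorem memLp_top_and_integrable_slice (hGm : Measurable (uncurry G)) (hGb : ∀ s x, ‖G s x‖ ≤ M)
    (hKc : IsCompact K) (hGK : ∀ s x, x ∉ K → G s x = 0) (s : ℝ) :
    MemLp (G s) ∞ (volume : Measure E) ∧ Integrable (G s) volume := by
  have hm : Measurable (G s) := hGm.comp (measurable_const.prodMk measurable_id)
  refine ⟨memLp_top_of_bound hm.aestronglyMeasurable M (Eventually.of_forall (hGb s)), ?_⟩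
  have hM0 : 0 ≤ M := (norm_nonneg _).trans (hGb s 0)
  refine Integrable.mono' ((integrableOn_const (C := M) (hKc.measure_lt_top).ne).integrable_indicator
    hKc.measurableSet) hm.aestronglyMeasurable (Eventually.of_forall fun x => ?_)
  by_cases hx : x ∈ K
  · rw [indicator_of_mem hx]; exact hGb s x
  · rw [hGK s x hx, norm_zero, indicator_of_notMem hx]

/-- **The forward duality integrand** `Φ(s, t, x) = 1_{0<s<t} ⟪e^{(t-s)Δ}G(s)(x), Θ(t, x)⟫` on
`ℝ × ℝ × E` (variables ordered `(s, (t, x))`): its integral over `ℝ × ℝ × E` is both sides of the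
forcing identity `setIntegral_inner_heatDuhamelBack_eq`. [folklore] -/
def dualityForwardIntegrand (G Θ : ℝ → E → E) (p : ℝ × ℝ × E) : ℝ :=
  if p.1 ∈ Ioo 0 p.2.1 then
    ⟪UnboundedOperators.heatExtension (G p.1) (p.2.1 - p.1) p.2.2, Θ p.2.1 p.2.2⟫ else 0

/-- **The adjoint duality integrand** `Ψ(t, s, x) = 1_{0<s<T} 1_{s<t} ⟪G(s, x), e^{(t-s)Δ}Θ(t)(x)⟫`
on `ℝ × ℝ × E` (variables ordered `(t, (s, x))`): the integrand of `∫∫ ⟪G, 𝒰[Θ]⟫` after the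
substitution `σ = t - s`. [folklore] -/
def dualityAdjointIntegrand (G Θ : ℝ → E → E) (T : ℝ) (p : ℝ × ℝ × E) : ℝ :=
  if p.2.1 ∈ Ioo 0 T ∧ p.2.1 < p.1 then
    ⟪G p.2.1 p.2.2, UnboundedOperators.heatExtension (Θ p.1) (p.1 - p.2.1) p.2.2⟫ else 0

/-- On `0 < s < t` the forward duality integrand is the pairing `⟪e^{(t-s)Δ}G(s)(x), Θ(t,x)⟫`. [folklore] -/
theorem dualityForwardIntegrand_of_mem {s : ℝ} {z : ℝ × E} (h : s ∈ Ioo 0 z.1) :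
    dualityForwardIntegrand G Θ (s, z) =
      ⟪UnboundedOperators.heatExtension (G s) (z.1 - s) z.2, Θ z.1 z.2⟫ :=
  if_pos h

/-- Off `0 < s < t` the forward duality integrand vanishes. [folklore] -/
theorem dualityForwardIntegrand_of_not_mem {s : ℝ} {z : ℝ × E} (h : s ∉ Ioo 0 z.1) :
    dualityForwardIntegrand G Θ (s, z) = 0 :=
  if_neg h

/-- On `0 < s < T`, `s < t` the adjoint duality integrand is the pairing
`⟪G(s,x), e^{(t-s)Δ}Θ(t)(x)⟫`. [folklore] -/
theorem dualityAdjointIntegrand_of_pos {t : ℝ} {z : ℝ × E} (h : z.1 ∈ Ioo 0 T ∧ z.1 < t) :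
    dualityAdjointIntegrand G Θ T (t, z) =
      ⟪G z.1 z.2, UnboundedOperators.heatExtension (Θ t) (t - z.1) z.2⟫ :=
  if_pos h

/-- Otherwise the adjoint duality integrand vanishes. [folklore] -/
theorem dualityAdjointIntegrand_of_neg {t : ℝ} {z : ℝ × E} (h : ¬ (z.1 ∈ Ioo 0 T ∧ z.1 < t)) :
    dualityAdjointIntegrand G Θ T (t, z) = 0 :=
  if_neg h

/-- The forward duality integrand is measurable for jointly measurable `G` and `Θ`. [folklore] -/
theorem measurable_dualityForwardIntegrand (hGm : Measurable (uncurry G)) (hΘm : Measurable (uncurry Θ)) :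
    Measurable (dualityForwardIntegrand G Θ) := by
  have hS : MeasurableSet {p : ℝ × ℝ × E | p.1 ∈ Ioo 0 p.2.1} := by
    have : {p : ℝ × ℝ × E | p.1 ∈ Ioo 0 p.2.1} = {p | 0 < p.1} ∩ {p | p.1 < p.2.1} := by
      ext p; simp [mem_Ioo]
    rw [this]
    exact (measurableSet_lt measurable_const measurable_fst).inter
      (measurableSet_lt measurable_fst measurable_snd.fst)
  unfold dualityForwardIntegrand
  refine Measurable.ite hS ?_ measurable_const
  exact (measurable_heatExtension_slice_sub hGm).inner (hΘm.comp measurable_snd)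

/-- The adjoint duality integrand is measurable for jointly measurable `G` and `Θ`. [folklore] -/
theorem measurable_dualityAdjointIntegrand (hGm : Measurable (uncurry G)) (hΘm : Measurable (uncurry Θ))
    (T : ℝ) : Measurable (dualityAdjointIntegrand G Θ T) := by
  have hS : MeasurableSet {p : ℝ × ℝ × E | p.2.1 ∈ Ioo 0 T ∧ p.2.1 < p.1} := by
    have : {p : ℝ × ℝ × E | p.2.1 ∈ Ioo 0 T ∧ p.2.1 < p.1} =
        ({p | 0 < p.2.1} ∩ {p | p.2.1 < T}) ∩ {p | p.2.1 < p.1} := by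
      ext p; simp [mem_Ioo, and_assoc]
    rw [this]
    exact ((measurableSet_lt measurable_const measurable_snd.fst).inter
      (measurableSet_lt measurable_snd.fst measurable_const)).inter
      (measurableSet_lt measurable_snd.fst measurable_fst)
  have hH : Measurable fun p : ℝ × ℝ × E =>
      UnboundedOperators.heatExtension (Θ p.1) (p.1 - p.2.1) p.2.2 := by
    have hg : Measurable fun p : ℝ × ℝ × E => ((p.1, p.1 - p.2.1, p.2.2) : ℝ × ℝ × E) :=
      measurable_fst.prodMk ((measurable_fst.sub measurable_snd.fst).prodMk measurable_snd.snd)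
    change Measurable ((fun p : ℝ × ℝ × E => UnboundedOperators.heatExtension (Θ p.1) p.2.1 p.2.2) ∘
      fun p : ℝ × ℝ × E => ((p.1, p.1 - p.2.1, p.2.2) : ℝ × ℝ × E))
    exact (measurable_heatExtension_slice hΘm).comp hg
  unfold dualityAdjointIntegrand
  refine Measurable.ite hS ?_ measurable_const
  exact (hGm.comp measurable_snd).inner hH

/-- Standing data of a test field on the slab `(0, T) × E`: a bound, the time support, the
vanishing off `(0, T)`. [folklore] -/
theorem IsSpaceTimeTestOn.slab_data (hT : 0 < T) (hΘ : IsSpaceTimeTestOn (slab E (Ioo 0 T) isOpen_Ioo) Θ) :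
    ∃ MΘ : ℝ, 0 ≤ MΘ ∧ (∀ t x, ‖Θ t x‖ ≤ MΘ) ∧ (∀ t, t ∉ Ioo 0 T → Θ t = 0) ∧
      Integrable (uncurry Θ) (volume : Measure (ℝ × E)) := by
  have hΘ' : IsSpaceTimeTestOn (⊤ : Opens (ℝ × E)) Θ := hΘ.mono le_top
  obtain ⟨a, b', ha0, -, hbT, hab⟩ := hΘ.exists_time_support_Ioo hT
  obtain ⟨MΘ, hMΘ0, hMΘ⟩ := hΘ'.exists_norm_le
  exact ⟨MΘ, hMΘ0, hMΘ, fun t ht => hab t fun h => ht ⟨lt_of_lt_of_le ha0 h.1, lt_of_le_of_lt h.2 hbT⟩,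
    hΘ'.contDiff.continuous.integrable_of_hasCompactSupport hΘ'.hasCompactSupport⟩

/-- **Integrability of the forward duality integrand**:
`|Φ(s, t, x)| ≤ M 1_{(0,T)}(s) ‖Θ(t, x)‖`. [folklore] -/
theorem integrable_dualityForwardIntegrand (hGm : Measurable (uncurry G)) (hGb : ∀ s x, ‖G s x‖ ≤ M)
    (hT : 0 < T) (hΘ : IsSpaceTimeTestOn (slab E (Ioo 0 T) isOpen_Ioo) Θ) :
    Integrable (dualityForwardIntegrand G Θ) (volume : Measure (ℝ × ℝ × E)) := by
  have hΘ' : IsSpaceTimeTestOn (⊤ : Opens (ℝ × E)) Θ := hΘ.mono le_top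
  obtain ⟨MΘ, hMΘ0, hMΘ, hΘzero, hΘi⟩ := hΘ.slab_data hT
  have hM0 : 0 ≤ M := (norm_nonneg _).trans (hGb 0 0)
  have hΦb : ∀ p : ℝ × ℝ × E, ‖dualityForwardIntegrand G Θ p‖ ≤
      (Ioo 0 T).indicator (fun _ => M) p.1 * ‖uncurry Θ p.2‖ := by
    rintro ⟨s, t, x⟩
    have h0 : 0 ≤ (Ioo 0 T).indicator (fun _ => M) s * ‖uncurry Θ (t, x)‖ :=
      mul_nonneg (indicator_nonneg (fun _ _ => hM0) _) (norm_nonneg _)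
    by_cases hst : s ∈ Ioo 0 t
    · rw [dualityForwardIntegrand_of_mem (z := (t, x)) hst]
      by_cases ht : t ∈ Ioo 0 T
      · have hs : s ∈ Ioo 0 T := ⟨hst.1, hst.2.trans ht.2⟩
        rw [indicator_of_mem hs]
        exact (norm_inner_le_norm _ _).trans (mul_le_mul_of_nonneg_right
          (UnboundedOperators.norm_heatExtension_le (hGb s) (sub_pos.2 hst.2) x) (norm_nonneg _))
      · have : Θ t x = 0 := by rw [hΘzero t ht]; rfl
        rw [this, inner_zero_right, norm_zero]
        exact h0
    · rw [dualityForwardIntegrand_of_not_mem (z := (t, x)) hst, norm_zero]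
      exact h0
  have hind : Integrable ((Ioo 0 T).indicator fun _ : ℝ => M) (volume : Measure ℝ) :=
    (integrableOn_const (C := M) (measure_Ioo_lt_top (a := (0 : ℝ)) (b := T)).ne).integrable_indicator
      measurableSet_Ioo
  have hprod := hind.mul_prod hΘi.norm
  rw [Measure.volume_eq_prod]
  exact hprod.mono' (measurable_dualityForwardIntegrand hGm hΘ'.contDiff.continuous.measurable).aestronglyMeasurable
    (Eventually.of_forall hΦb)

/-- **Integrability of the adjoint duality integrand**:
`|Ψ(t, s, x)| ≤ MΘ 1_{(0,T)}(t) · M 1_{(0,T)×K}(s, x)`. [folklore] -/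
theorem integrable_dualityAdjointIntegrand (hGm : Measurable (uncurry G)) (hGb : ∀ s x, ‖G s x‖ ≤ M)
    (hKc : IsCompact K) (hGK : ∀ s x, x ∉ K → G s x = 0)
    (hT : 0 < T) (hΘ : IsSpaceTimeTestOn (slab E (Ioo 0 T) isOpen_Ioo) Θ) :
    Integrable (dualityAdjointIntegrand G Θ T) (volume : Measure (ℝ × ℝ × E)) := by
  have hΘ' : IsSpaceTimeTestOn (⊤ : Opens (ℝ × E)) Θ := hΘ.mono le_top
  obtain ⟨MΘ, hMΘ0, hMΘ, hΘzero, -⟩ := hΘ.slab_data hT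
  have hM0 : 0 ≤ M := (norm_nonneg _).trans (hGb 0 0)
  have hΨb : ∀ p : ℝ × ℝ × E, ‖dualityAdjointIntegrand G Θ T p‖ ≤
      (Ioo 0 T).indicator (fun _ => MΘ) p.1 * (Ioo 0 T ×ˢ K).indicator (fun _ => M) p.2 := by
    rintro ⟨t, s, x⟩
    have h0 : 0 ≤ (Ioo 0 T).indicator (fun _ => MΘ) t * (Ioo 0 T ×ˢ K).indicator (fun _ => M) (s, x) :=
      mul_nonneg (indicator_nonneg (fun _ _ => hMΘ0) _) (indicator_nonneg (fun _ _ => hM0) _)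
    by_cases hc : s ∈ Ioo 0 T ∧ s < t
    · rw [dualityAdjointIntegrand_of_pos (z := (s, x)) hc]
      by_cases ht : t ∈ Ioo 0 T
      · by_cases hx : x ∈ K
        · rw [indicator_of_mem ht, indicator_of_mem (show ((s, x) : ℝ × E) ∈ Ioo 0 T ×ˢ K from ⟨hc.1, hx⟩)]
          calc ‖⟪G s x, UnboundedOperators.heatExtension (Θ t) (t - s) x⟫‖
              ≤ ‖G s x‖ * ‖UnboundedOperators.heatExtension (Θ t) (t - s) x‖ := norm_inner_le_norm _ _
            _ ≤ M * MΘ := mul_le_mul (hGb s x)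
                (UnboundedOperators.norm_heatExtension_le (hMΘ t) (sub_pos.2 hc.2) x) (norm_nonneg _) hM0
            _ = MΘ * M := mul_comm _ _
        · rw [hGK s x hx, inner_zero_left, norm_zero]; exact h0
      · have : UnboundedOperators.heatExtension (Θ t) (t - s) x = 0 := by
          rw [hΘzero t ht]; exact congrFun (UnboundedOperators.heatExtension_zero_fun _) _
        rw [this, inner_zero_right, norm_zero]; exact h0
    · rw [dualityAdjointIntegrand_of_neg (z := (s, x)) hc, norm_zero]; exact h0
  have hind1 : Integrable ((Ioo 0 T).indicator fun _ : ℝ => MΘ) (volume : Measure ℝ) :=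
    (integrableOn_const (C := MΘ) (measure_Ioo_lt_top (a := (0 : ℝ)) (b := T)).ne).integrable_indicator
      measurableSet_Ioo
  have hfin : (volume : Measure (ℝ × E)) (Ioo 0 T ×ˢ K) ≠ ⊤ := by
    rw [Measure.volume_eq_prod, Measure.prod_prod]
    exact ENNReal.mul_ne_top measure_Ioo_lt_top.ne hKc.measure_lt_top.ne
  have hind2 : Integrable ((Ioo 0 T ×ˢ K).indicator fun _ : ℝ × E => M) (volume : Measure (ℝ × E)) :=
    (integrableOn_const (C := M) hfin).integrable_indicator (measurableSet_Ioo.prod hKc.measurableSet)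
  have hprod := hind1.mul_prod hind2
  rw [Measure.volume_eq_prod]
  exact hprod.mono' (measurable_dualityAdjointIntegrand hGm hΘ'.contDiff.continuous.measurable T).aestronglyMeasurable
    (Eventually.of_forall hΨb)

/-- **The right-hand side of the forcing identity is the integral of the forward integrand**:
`∫∫_{(0,T)×E} ⟪∫₀ᵗ e^{(t-s)Δ}G(s) ds, Θ(t)⟫ = ∫ Φ` (the inner product passes inside the
`s`-integral; off `(0, T)` in time `Θ` vanishes; Fubini). [folklore] -/
theorem setIntegral_inner_duhamel_eq_integral_forward (hGm : Measurable (uncurry G))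
    (hGb : ∀ s x, ‖G s x‖ ≤ M) (hT : 0 < T) (hΘ : IsSpaceTimeTestOn (slab E (Ioo 0 T) isOpen_Ioo) Θ) :
    ∫ z in Ioo 0 T ×ˢ (univ : Set E),
        ⟪(∫ s in Ioo 0 z.1, UnboundedOperators.heatExtension (G s) (z.1 - s) z.2), Θ z.1 z.2⟫ =
      ∫ p, dualityForwardIntegrand G Θ p := by
  obtain ⟨MΘ, hMΘ0, hMΘ, hΘzero, -⟩ := hΘ.slab_data hT
  have hHm := measurable_heatExtension_slice_sub hGm
  have hΦi := integrable_dualityForwardIntegrand hGm hGb hT hΘ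
  -- the inner product passes inside, and the set integral becomes an integral of `Φ`
  have hR1 : ∀ z : ℝ × E,
      ⟪(∫ s in Ioo 0 z.1, UnboundedOperators.heatExtension (G s) (z.1 - s) z.2), Θ z.1 z.2⟫ =
        ∫ s, dualityForwardIntegrand G Θ (s, z) := by
    rintro ⟨t, x⟩
    have hint : IntegrableOn (fun s => UnboundedOperators.heatExtension (G s) (t - s) x) (Ioo 0 t) volume := by
      have hg : Measurable fun s : ℝ => ((s, t, x) : ℝ × ℝ × E) :=
        measurable_id.prodMk (measurable_const.prodMk measurable_const)
      have hm : Measurable fun s => UnboundedOperators.heatExtension (G s) (t - s) x := by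
        change Measurable ((fun p : ℝ × ℝ × E =>
          UnboundedOperators.heatExtension (G p.1) (p.2.1 - p.1) p.2.2) ∘ fun s : ℝ => ((s, t, x) : ℝ × ℝ × E))
        exact hHm.comp hg
      refine Integrable.mono' (integrableOn_const (C := M) (measure_Ioo_lt_top).ne)
        hm.aestronglyMeasurable ?_
      filter_upwards [ae_restrict_mem measurableSet_Ioo] with s hs
      exact UnboundedOperators.norm_heatExtension_le (hGb s) (sub_pos.2 hs.2) x
    have h1 : ⟪(∫ s in Ioo 0 t, UnboundedOperators.heatExtension (G s) (t - s) x), Θ t x⟫ =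
        ∫ s in Ioo 0 t, ⟪UnboundedOperators.heatExtension (G s) (t - s) x, Θ t x⟫ := by
      rw [real_inner_comm, ← integral_inner hint]
      exact integral_congr_ae (Eventually.of_forall fun s => real_inner_comm _ _)
    have h2 : ∫ s in Ioo 0 t, ⟪UnboundedOperators.heatExtension (G s) (t - s) x, Θ t x⟫ =
        ∫ s, (Ioo 0 t).indicator (fun s => ⟪UnboundedOperators.heatExtension (G s) (t - s) x, Θ t x⟫) s :=
      (integral_indicator measurableSet_Ioo).symm
    simp only
    rw [h1, h2]
    refine integral_congr_ae (Eventually.of_forall fun s => ?_)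
    show _ = dualityForwardIntegrand G Θ (s, t, x)
    by_cases hs : s ∈ Ioo 0 t
    · rw [indicator_of_mem hs, dualityForwardIntegrand_of_mem (z := (t, x)) hs]
    · rw [indicator_of_notMem hs, dualityForwardIntegrand_of_not_mem (z := (t, x)) hs]
  rw [setIntegral_congr_fun (measurableSet_Ioo.prod MeasurableSet.univ) (fun z _ => hR1 z)]
  -- drop the restriction to the slab: off `(0,T)` in time the integrand vanishes
  have hR2 : ∫ z in Ioo 0 T ×ˢ (univ : Set E), ∫ s, dualityForwardIntegrand G Θ (s, z) =
      ∫ z : ℝ × E, ∫ s, dualityForwardIntegrand G Θ (s, z) := by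
    refine setIntegral_eq_integral_of_forall_compl_eq_zero fun z hz => ?_
    have ht : z.1 ∉ Ioo 0 T := fun h => hz ⟨h, mem_univ _⟩
    have hz0 : ∀ s, dualityForwardIntegrand G Θ (s, z) = 0 := fun s => by
      by_cases hs : s ∈ Ioo 0 z.1
      · rw [dualityForwardIntegrand_of_mem hs]
        have : Θ z.1 z.2 = 0 := by rw [hΘzero z.1 ht]; rfl
        rw [this, inner_zero_right]
      · exact dualityForwardIntegrand_of_not_mem hs
    simp [hz0]
  rw [hR2, integral_eq_integral_integral_swap hΦi]

/-- **The left-hand side of the forcing identity is the integral of the adjoint integrand**: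
`∫∫_{(0,T)×E} ⟪G, 𝒰[Θ]⟫ = ∫_{(s,x)} ∫_t Ψ(t, (s, x))` (the inner product passes inside the
Duhamel integral and the substitution `t = s + σ`). [folklore] -/
theorem setIntegral_inner_heatDuhamelBack_eq_integral_adjoint
    (hΘ : IsSpaceTimeTestOn (slab E (Ioo 0 T) isOpen_Ioo) Θ) :
    ∫ z in Ioo 0 T ×ˢ (univ : Set E), ⟪G z.1 z.2, heatDuhamelBack 1 Θ z.1 z.2⟫ =
      ∫ z : ℝ × E, ∫ t, dualityAdjointIntegrand G Θ T (t, z) := by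
  have hΘ' : IsSpaceTimeTestOn (⊤ : Opens (ℝ × E)) Θ := hΘ.mono le_top
  -- (L1) pointwise on the slab: `⟪G(s,x), 𝒰(s,x)⟫ = ∫_t Ψ(t, (s, x))`
  have hL1 : ∀ z : ℝ × E, z.1 ∈ Ioo 0 T →
      ⟪G z.1 z.2, heatDuhamelBack 1 Θ z.1 z.2⟫ = ∫ t, dualityAdjointIntegrand G Θ T (t, z) := by
    rintro ⟨s, x⟩ hs
    have hFi := hΘ'.integrableOn_duhamelIntegrand one_pos s x
    rw [heatDuhamelBack_apply, ← integral_inner hFi, ← integral_indicator measurableSet_Ioi]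
    -- substitution `t = s + σ`
    have hsub : (fun σ : ℝ => (Ioi (0 : ℝ)).indicator
        (fun σ => ⟪G s x, UnboundedOperators.heatExtension (Θ (s + σ)) (1 * σ) x⟫) σ) =
        fun σ => dualityAdjointIntegrand G Θ T (s + σ, (s, x)) := by
      funext σ
      by_cases hσ : 0 < σ
      · rw [indicator_of_mem (show σ ∈ Ioi (0 : ℝ) from hσ),
          dualityAdjointIntegrand_of_pos (z := (s, x)) ⟨hs, by simp only; linarith⟩]
        simp only [one_mul, add_sub_cancel_left]
      · rw [indicator_of_notMem (show σ ∉ Ioi (0 : ℝ) from hσ),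
          dualityAdjointIntegrand_of_neg (z := (s, x)) (fun h => hσ (by
            have := h.2; simp only at this; linarith))]
    rw [hsub]
    exact integral_add_left_eq_self (μ := (volume : Measure ℝ))
      (fun t => dualityAdjointIntegrand G Θ T (t, (s, x))) s
  rw [setIntegral_congr_fun (measurableSet_Ioo.prod MeasurableSet.univ) (fun z hz => hL1 z hz.1)]
  refine setIntegral_eq_integral_of_forall_compl_eq_zero fun z hz => ?_
  have hs : z.1 ∉ Ioo 0 T := fun h => hz ⟨h, mem_univ _⟩
  have hz0 : ∀ t, dualityAdjointIntegrand G Θ T (t, z) = 0 := fun t =>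
    dualityAdjointIntegrand_of_neg (fun h => hs h.1)
  simp [hz0]

/-- **Symmetry of the heat semigroup, slice by slice**: for all `s, t`,
`∫_x Ψ(t, (s, x)) = ∫_x Φ(s, (t, x))`. [folklore] -/
theorem integral_dualityAdjointIntegrand_slice_eq (hGm : Measurable (uncurry G))
    (hGb : ∀ s x, ‖G s x‖ ≤ M) (hKc : IsCompact K) (hGK : ∀ s x, x ∉ K → G s x = 0) (hT : 0 < T)
    (hΘ : IsSpaceTimeTestOn (slab E (Ioo 0 T) isOpen_Ioo) Θ) (s t : ℝ) :
    ∫ x, dualityAdjointIntegrand G Θ T (t, (s, x)) = ∫ x, dualityForwardIntegrand G Θ (s, (t, x)) := by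
  have hΘ' : IsSpaceTimeTestOn (⊤ : Opens (ℝ × E)) Θ := hΘ.mono le_top
  obtain ⟨MΘ, hMΘ0, hMΘ, hΘzero, -⟩ := hΘ.slab_data hT
  by_cases hc : s ∈ Ioo 0 T ∧ s < t
  · have hst : s ∈ Ioo 0 t := ⟨hc.1.1, hc.2⟩
    by_cases ht : t ∈ Ioo 0 T
    · have e1 : ∀ x, dualityAdjointIntegrand G Θ T (t, (s, x)) =
          ⟪G s x, UnboundedOperators.heatExtension (Θ t) (t - s) x⟫ := fun x =>
        dualityAdjointIntegrand_of_pos (z := (s, x)) hc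
      have e2 : ∀ x, dualityForwardIntegrand G Θ (s, (t, x)) =
          ⟪UnboundedOperators.heatExtension (G s) (t - s) x, Θ t x⟫ := fun x =>
        dualityForwardIntegrand_of_mem (z := (t, x)) hst
      simp_rw [e1, e2]
      haveI : ENNReal.HolderConjugate (∞ : ℝ≥0∞) 1 := ENNReal.HolderConjugate.symm
      have hΘt : MemLp (Θ t) 1 (volume : Measure E) :=
        memLp_one_iff_integrable.2 ((hΘ'.contDiff_slice t).continuous.integrable_of_hasCompactSupport
          (hΘ'.hasCompactSupport_slice t))
      exact integral_inner_heatExtension_comm (p := ∞) (q := 1)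
        (memLp_top_and_integrable_slice hGm hGb hKc hGK s).1 hΘt (sub_pos.2 hc.2)
    · have e1 : ∀ x, dualityAdjointIntegrand G Θ T (t, (s, x)) = 0 := fun x => by
        rw [dualityAdjointIntegrand_of_pos (z := (s, x)) hc]
        have : UnboundedOperators.heatExtension (Θ t) (t - s) x = 0 := by
          rw [hΘzero t ht]; exact congrFun (UnboundedOperators.heatExtension_zero_fun _) _
        rw [this, inner_zero_right]
      have e2 : ∀ x, dualityForwardIntegrand G Θ (s, (t, x)) = 0 := fun x => by
        rw [dualityForwardIntegrand_of_mem (z := (t, x)) hst]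
        have : Θ t x = 0 := by rw [hΘzero t ht]; rfl
        rw [this, inner_zero_right]
      simp_rw [e1, e2]
  · have e1 : ∀ x, dualityAdjointIntegrand G Θ T (t, (s, x)) = 0 := fun x =>
      dualityAdjointIntegrand_of_neg hc
    have e2 : ∀ x, dualityForwardIntegrand G Θ (s, (t, x)) = 0 := fun x => by
      by_cases hst : s ∈ Ioo 0 t
      · rw [dualityForwardIntegrand_of_mem (z := (t, x)) hst]
        have hTs : T ≤ s := by
          by_contra h; exact hc ⟨⟨hst.1, not_le.1 h⟩, hst.2⟩
        have ht : t ∉ Ioo 0 T := fun h => (lt_irrefl T) (lt_of_le_of_lt hTs (hst.2.trans h.2))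
        have : Θ t x = 0 := by rw [hΘzero t ht]; rfl
        rw [this, inner_zero_right]
      · exact dualityForwardIntegrand_of_not_mem hst
    simp_rw [e1, e2]

/-- **The forcing term of the duality identity as a slab pairing with the forward Duhamel
integral.** For a bounded jointly measurable field `G` vanishing off a compact set and a
space–time test field `Θ` on `(0, T) × E`,
`∫∫_{(0,T)×E} ⟪G, 𝒰[Θ]⟫ = ∫∫_{(0,T)×E} ⟪∫₀ᵗ e^{(t-s)Δ}G(s) ds, Θ(t)⟫`: both sides are the
integral over `ℝ × ℝ × E` of `Φ(s, t, x) = 1_{0<s<t} ⟪e^{(t-s)Δ}G(s)(x), Θ(t, x)⟫`, the left one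
after the substitution `σ = t - s` in `𝒰[Θ](s) = ∫_{σ>0} e^{σΔ}Θ(s+σ) dσ`, Fubini, and the
symmetry of the heat semigroup on each pair of slices (Lemarié-Rieusset 2016, Prop. 4.3: the
backward Duhamel integral is the adjoint of the forward one). [cite: LemarieRieusset2016, Prop. 4.3 pp. 74–75] -/
theorem setIntegral_inner_heatDuhamelBack_eq (hGm : Measurable (uncurry G)) (hGb : ∀ s x, ‖G s x‖ ≤ M)
    (hKc : IsCompact K) (hGK : ∀ s x, x ∉ K → G s x = 0) (hT : 0 < T)
    (hΘ : IsSpaceTimeTestOn (slab E (Ioo 0 T) isOpen_Ioo) Θ) :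
    ∫ z in Ioo 0 T ×ˢ (univ : Set E), ⟪G z.1 z.2, heatDuhamelBack 1 Θ z.1 z.2⟫ =
      ∫ z in Ioo 0 T ×ˢ (univ : Set E),
        ⟪(∫ s in Ioo 0 z.1, UnboundedOperators.heatExtension (G s) (z.1 - s) z.2), Θ z.1 z.2⟫ := by
  have hΦi := integrable_dualityForwardIntegrand hGm hGb hT hΘ
  have hΨi := integrable_dualityAdjointIntegrand hGm hGb hKc hGK hT hΘ
  rw [setIntegral_inner_duhamel_eq_integral_forward hGm hGb hT hΘ,
    setIntegral_inner_heatDuhamelBack_eq_integral_adjoint hΘ,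
    ← integral_eq_integral_integral_swap hΨi, integral_eq_integral_integral_integral hΨi,
    integral_eq_integral_integral_integral hΦi, integral_integral_integral_swap_time hΦi]
  refine integral_congr_ae (Eventually.of_forall fun t => ?_)
  exact integral_congr_ae (Eventually.of_forall fun s =>
    integral_dualityAdjointIntegrand_slice_eq hGm hGb hKc hGK hT hΘ s t)

end Forcing

/-! ### The gradient term: `∫∫ ⟪G, ∂ᵥ𝒰[Θ]⟫ = -∫∫ ⟪∫₀ᵗ ∂ᵥe^{(t-s)Δ}G(s) ds, Θ⟫` -/

section Gradient

variable {F' : Type*} [NormedAddCommGroup F'] [NormedSpace ℝ F']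
variable {G : ℝ → E → E} {M : ℝ} {K : Set E} {T : ℝ} {Θ : ℝ → E → E}

omit [MeasurableSpace E] [BorelSpace E] [FiniteDimensional ℝ E] in
/-- **Directional derivatives of a space–time test field are space–time test fields on the same
region** (the support can only shrink). [folklore] -/
theorem IsSpaceTimeTestOn.fderiv_apply_slice {Q : Opens (ℝ × E)} {ψ : ℝ → E → F'}
    (hψ : IsSpaceTimeTestOn Q ψ) (v : E) :
    IsSpaceTimeTestOn Q (fun t y => fderiv ℝ (ψ t) y v) := by
  have htop := (hψ.mono le_top).fderiv_apply_top v
  refine ⟨htop.contDiff, htop.hasCompactSupport, ?_⟩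
  -- `tsupport (∂ᵥψ) ⊆ tsupport ψ ⊆ Q`
  refine (closure_minimal ?_ (isClosed_tsupport _)).trans hψ.tsupport_subset
  intro z hz
  by_contra hzs
  apply hz
  show fderiv ℝ (ψ z.1) z.2 v = 0
  -- `ψ z.1` vanishes near `z.2`
  have hnhds : (tsupport (uncurry ψ))ᶜ ∈ 𝓝 z := (isClosed_tsupport _).isOpen_compl.mem_nhds hzs
  have hev : (ψ z.1) =ᶠ[𝓝 z.2] fun _ => 0 := by
    have h2 : (fun y => (z.1, y)) ⁻¹' (tsupport (uncurry ψ))ᶜ ∈ 𝓝 z.2 :=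
      (Continuous.prodMk_right z.1).continuousAt hnhds
    filter_upwards [h2] with y hy
    have hy' : (z.1, y) ∉ tsupport (uncurry ψ) := hy
    exact image_eq_zero_of_notMem_tsupport (f := uncurry ψ) hy'
  rw [hev.fderiv_eq, fderiv_const_apply]
  rfl

/-- **The forward Duhamel integral of bounded data is `C¹` in space, with the derivative under the
integral sign**: for `G` jointly measurable and bounded by `M`, and `0 < t`, the slice
`V(x) = ∫_{s∈(0,t)} e^{(t-s)Δ}G(s)(x) ds` is `C¹`, and at every point `x₀` the integrand of
`∫_{s∈(0,t)} D(e^{(t-s)Δ}G(s))(x₀) ds` is integrable and this integral is the derivative of `V`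
(dominating bound `2^{dim/2}(t-s)^{-1/2}M`, integrable on `(0, t)`; the tree's dominated iterated
differentiation `FunctionSpaces.contDiff_integral_of_dominated_iteratedFDeriv` at order `1`). [folklore] -/
theorem duhamel_slice_contDiff_one_and_hasFDerivAt (hGm : Measurable (uncurry G))
    (hGb : ∀ s x, ‖G s x‖ ≤ M) {t : ℝ} (ht : 0 < t) :
    ContDiff ℝ 1 (fun x => ∫ s in Ioo 0 t, UnboundedOperators.heatExtension (G s) (t - s) x) ∧
    ∀ x₀ : E,
      Integrable (fun s => fderiv ℝ (UnboundedOperators.heatExtension (G s) (t - s)) x₀)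
        ((volume : Measure ℝ).restrict (Ioo 0 t)) ∧
      HasFDerivAt (fun x => ∫ s in Ioo 0 t, UnboundedOperators.heatExtension (G s) (t - s) x)
        (∫ s in Ioo 0 t, fderiv ℝ (UnboundedOperators.heatExtension (G s) (t - s)) x₀) x₀ := by
  haveI : CompleteSpace E := FiniteDimensional.complete ℝ E
  have hM0 : 0 ≤ M := (norm_nonneg _).trans (hGb 0 0)
  have hGs : ∀ s, Measurable (G s) := fun s => hGm.comp (measurable_const.prodMk measurable_id)
  -- the indicator-extended integrand, with smooth slices everywhere
  set W : ℝ → E → E := (Ioo 0 t).indicator fun s => UnboundedOperators.heatExtension (G s) (t - s) with hW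
  have hWmem : ∀ {s}, s ∈ Ioo 0 t → W s = UnboundedOperators.heatExtension (G s) (t - s) := fun hs =>
    indicator_of_mem hs _
  have hWnot : ∀ {s}, s ∉ Ioo 0 t → W s = 0 := fun hs => indicator_of_notMem hs _
  have hWsmooth : ∀ s, ContDiff ℝ ∞ (W s) := fun s => by
    by_cases hs : s ∈ Ioo 0 t
    · rw [hWmem hs]
      exact (UnboundedOperators.contDiff_heatExtension_holds
        (memLp_top_of_bound (hGs s).aestronglyMeasurable M (Eventually.of_forall (hGb s))) le_top
        (sub_pos.2 hs.2)).of_le (by exact_mod_cast le_top)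
    · rw [hWnot hs]; exact contDiff_const
  have hHm := measurable_heatExtension_slice_sub hGm
  have hWm : StronglyMeasurable (uncurry W) := by
    have hS : MeasurableSet {q : ℝ × E | q.1 ∈ Ioo 0 t} := measurableSet_Ioo.preimage measurable_fst
    have hHt : Measurable fun q : ℝ × E => UnboundedOperators.heatExtension (G q.1) (t - q.1) q.2 := by
      have hg : Measurable fun q : ℝ × E => ((q.1, t, q.2) : ℝ × ℝ × E) :=
        measurable_fst.prodMk (measurable_const.prodMk measurable_snd)
      change Measurable ((fun p : ℝ × ℝ × E =>
        UnboundedOperators.heatExtension (G p.1) (p.2.1 - p.1) p.2.2) ∘ fun q : ℝ × E => ((q.1, t, q.2) : ℝ × ℝ × E))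
      exact hHm.comp hg
    have heq : uncurry W = {q : ℝ × E | q.1 ∈ Ioo 0 t}.piecewise
        (fun q : ℝ × E => UnboundedOperators.heatExtension (G q.1) (t - q.1) q.2) 0 := by
      funext q
      by_cases hq : q.1 ∈ Ioo 0 t
      · rw [piecewise_eq_of_mem _ _ _ (show q ∈ {q : ℝ × E | q.1 ∈ Ioo 0 t} from hq)]
        show W q.1 q.2 = _; rw [hWmem hq]
      · rw [piecewise_eq_of_notMem _ _ _ (show q ∉ {q : ℝ × E | q.1 ∈ Ioo 0 t} from hq)]
        show W q.1 q.2 = _; rw [hWnot hq]; rfl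
    rw [heq]
    exact hHt.stronglyMeasurable.piecewise hS stronglyMeasurable_const
  -- the dominated-differentiation package at order `1` on `μ = vol|_(0,t)`
  set μ : Measure ℝ := (volume : Measure ℝ).restrict (Ioo 0 t) with hμ
  set d2 : ℝ := (2 : ℝ) ^ ((Module.finrank ℝ E : ℝ) / 2) with hd2
  obtain ⟨hI, -⟩ := integrableOn_Ioo_sub_rpow_and_integral_eq (e := -(1 / 2 : ℝ)) ht (by norm_num)
  set bound : ℕ → ℝ → ℝ := fun i s => if i = 0 then M else d2 * M * ‖(t - s) ^ (-(1 / 2 : ℝ))‖ with hbound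
  have hbi : ∀ i ≤ 1, Integrable (bound i) μ := by
    intro i hi
    by_cases hi0 : i = 0
    · simp only [hbound, if_pos hi0]; exact integrableOn_const (measure_Ioo_lt_top.ne)
    · simp only [hbound, if_neg hi0]; exact hI.norm.const_mul _
  have hb : ∀ i ≤ 1, ∀ s x, ‖iteratedFDeriv ℝ i (W s) x‖ ≤ bound i s := by
    intro i hi s x
    by_cases hs : s ∈ Ioo 0 t
    · have hσ : 0 < t - s := sub_pos.2 hs.2
      by_cases hi0 : i = 0
      · subst hi0
        simp only [hbound, if_true]
        rw [norm_iteratedFDeriv_zero, hWmem hs]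
        exact UnboundedOperators.norm_heatExtension_le (hGb s) hσ x
      · obtain rfl : i = 1 := by omega
        simp only [hbound, if_neg hi0]
        rw [norm_iteratedFDeriv_one, hWmem hs]
        have h := UnboundedOperators.norm_fderiv_heatExtension_le_of_bounded (hGs s).aestronglyMeasurable
          (hGb s) hσ x
        calc ‖fderiv ℝ (UnboundedOperators.heatExtension (G s) (t - s)) x‖
            ≤ d2 * (t - s) ^ (-(1 / 2 : ℝ)) * M := h
          _ = d2 * M * (t - s) ^ (-(1 / 2 : ℝ)) := by ring
          _ ≤ d2 * M * ‖(t - s) ^ (-(1 / 2 : ℝ))‖ := by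
              have : 0 ≤ d2 * M := by positivity
              exact mul_le_mul_of_nonneg_left (Real.le_norm_self _) this
    · rw [hWnot hs, iteratedFDeriv_zero, Pi.zero_apply, norm_zero]
      by_cases hi0 : i = 0
      · simp only [hbound, if_pos hi0]; exact hM0
      · simp only [hbound, if_neg hi0]; positivity
  have hpack := FunctionSpaces.contDiff_integral_of_dominated_iteratedFDeriv (μ := μ) (m := 1) hWm hWsmooth hbi hb
  -- the integral of `W` over `μ` is the Duhamel slice
  have hVW : (fun x => ∫ s in Ioo 0 t, UnboundedOperators.heatExtension (G s) (t - s) x) =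
      fun x => ∫ s, W s x ∂μ := by
    funext x
    exact setIntegral_congr_fun measurableSet_Ioo fun s hs => by rw [hWmem hs]
  refine ⟨by rw [hVW]; exact hpack.1, fun x₀ => ?_⟩
  -- integrability of the derivative integrand and the derivative formula
  have hDm : StronglyMeasurable (fun q : ℝ × E => fderiv ℝ (W q.1) q.2) :=
    FunctionSpaces.stronglyMeasurable_fderiv_param hWm
      (fun s x => ((hWsmooth s).differentiable (by simp)).differentiableAt)
  have hF'_meas : AEStronglyMeasurable (fun s => fderiv ℝ (UnboundedOperators.heatExtension (G s) (t - s)) x₀) μ := by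
    have h1 : AEStronglyMeasurable (fun s => fderiv ℝ (W s) x₀) μ :=
      (hDm.comp_measurable (measurable_id.prodMk measurable_const)).aestronglyMeasurable
    refine h1.congr ?_
    filter_upwards [ae_restrict_mem measurableSet_Ioo] with s hs
    rw [hWmem hs]
  have hF'_bound : ∀ᵐ s ∂μ, ∀ x ∈ (univ : Set E),
      ‖fderiv ℝ (UnboundedOperators.heatExtension (G s) (t - s)) x‖ ≤ bound 1 s := by
    filter_upwards [ae_restrict_mem measurableSet_Ioo] with s hs x _
    have h := hb 1 le_rfl s x
    rwa [norm_iteratedFDeriv_one, hWmem hs] at h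
  have hF'_int : Integrable (fun s => fderiv ℝ (UnboundedOperators.heatExtension (G s) (t - s)) x₀) μ :=
    (hbi 1 le_rfl).mono' hF'_meas (hF'_bound.mono fun s hs => hs x₀ (mem_univ _))
  refine ⟨hF'_int, ?_⟩
  have hF_meas : ∀ x, AEStronglyMeasurable (fun s => UnboundedOperators.heatExtension (G s) (t - s) x) μ :=
    fun x => by
    have hg : Measurable fun s : ℝ => ((s, t, x) : ℝ × ℝ × E) :=
      measurable_id.prodMk (measurable_const.prodMk measurable_const)
    have : Measurable fun s => UnboundedOperators.heatExtension (G s) (t - s) x := by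
      change Measurable ((fun p : ℝ × ℝ × E =>
        UnboundedOperators.heatExtension (G p.1) (p.2.1 - p.1) p.2.2) ∘ fun s : ℝ => ((s, t, x) : ℝ × ℝ × E))
      exact hHm.comp hg
    exact this.aestronglyMeasurable
  have hF_int : Integrable (fun s => UnboundedOperators.heatExtension (G s) (t - s) x₀) μ := by
    refine Integrable.mono' (integrableOn_const (C := M) (measure_Ioo_lt_top).ne) (hF_meas x₀) ?_
    filter_upwards [ae_restrict_mem measurableSet_Ioo] with s hs
    exact UnboundedOperators.norm_heatExtension_le (hGb s) (sub_pos.2 hs.2) x₀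
  have h_diff : ∀ᵐ s ∂μ, ∀ x ∈ (univ : Set E),
      HasFDerivAt (fun x => UnboundedOperators.heatExtension (G s) (t - s) x)
        (fderiv ℝ (UnboundedOperators.heatExtension (G s) (t - s)) x) x := by
    filter_upwards [ae_restrict_mem measurableSet_Ioo] with s hs x _
    have hd : Differentiable ℝ (W s) := (hWsmooth s).differentiable (by simp)
    rw [hWmem hs] at hd
    exact (hd x).hasFDerivAt
  exact hasFDerivAt_integral_of_dominated_of_fderiv_le (μ := μ) (s := univ) univ_mem
    (Eventually.of_forall hF_meas) hF_int hF'_meas hF'_bound (hbi 1 le_rfl) h_diff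

/-- **Integration by parts against a test slice for the forward Duhamel integral**:
`∫ ⟪∫₀ᵗ e^{(t-s)Δ}G(s) ds (x), ∂ᵥθ(x)⟫ dx = -∫ ⟪∫₀ᵗ ∂ᵥ(e^{(t-s)Δ}G(s))(x) ds, θ(x)⟫ dx` for a
smooth compactly supported `θ` (Mathlib's bilinear integration by parts with the inner product,
the Duhamel slice being `C¹` with the derivative under the integral sign). [folklore] -/
theorem integral_inner_duhamel_fderiv_test_eq_neg (hGm : Measurable (uncurry G))
    (hGb : ∀ s x, ‖G s x‖ ≤ M) {t : ℝ} (ht : 0 < t) {θ : E → E}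
    (hθ : ContDiff ℝ ∞ θ) (hθc : HasCompactSupport θ) (v : E) :
    ∫ x, ⟪(∫ s in Ioo 0 t, UnboundedOperators.heatExtension (G s) (t - s) x), fderiv ℝ θ x v⟫ =
      -∫ x, ⟪(∫ s in Ioo 0 t, fderiv ℝ (UnboundedOperators.heatExtension (G s) (t - s)) x v), θ x⟫ := by
  obtain ⟨hC1, hpt⟩ := duhamel_slice_contDiff_one_and_hasFDerivAt hGm hGb ht
  set V : E → E := fun x => ∫ s in Ioo 0 t, UnboundedOperators.heatExtension (G s) (t - s) x with hV
  have hVc : Continuous V := hC1.continuous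
  have hDVc : Continuous (fderiv ℝ V) := hC1.continuous_fderiv one_ne_zero
  have hfd : ∀ x, fderiv ℝ V x = ∫ s in Ioo 0 t, fderiv ℝ (UnboundedOperators.heatExtension (G s) (t - s)) x :=
    fun x => (hpt x).2.fderiv
  have hθ1 : Continuous θ := hθ.continuous
  have hDθ : Continuous fun x => fderiv ℝ θ x v :=
    (hθ.continuous_fderiv (by simp)).clm_apply continuous_const
  have hDθc : HasCompactSupport fun x => fderiv ℝ θ x v :=
    (hθc.fderiv ℝ).mono' (fun x hx => by
      simp only [Function.mem_support, ne_eq] at hx ⊢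
      exact subset_tsupport _ (by
        simp only [Function.mem_support, ne_eq]
        intro h; exact hx (by rw [h]; rfl)))
  -- compact supports of the three pairings
  have hs1 : HasCompactSupport fun x => ⟪fderiv ℝ V x v, θ x⟫ :=
    hθc.mono fun x hx => by
      intro h; exact hx (show ⟪fderiv ℝ V x v, θ x⟫ = 0 by rw [h, inner_zero_right])
  have hs2 : HasCompactSupport fun x => ⟪V x, fderiv ℝ θ x v⟫ :=
    hDθc.mono fun x hx => by
      intro h; exact hx (show ⟪V x, fderiv ℝ θ x v⟫ = 0 by
        rw [show fderiv ℝ θ x v = 0 from h, inner_zero_right])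
  have hs3 : HasCompactSupport fun x => ⟪V x, θ x⟫ :=
    hθc.mono fun x hx => by
      intro h; exact hx (show ⟪V x, θ x⟫ = 0 by rw [h, inner_zero_right])
  -- the bilinear integration by parts
  have key := integral_bilinear_hasFDerivAt_right_eq_neg_left_of_integrable (μ := (volume : Measure E))
    (B := (innerSL ℝ : E →L[ℝ] E →L[ℝ] ℝ)) (f := V) (f' := fderiv ℝ V) (g := θ) (g' := fderiv ℝ θ) (v := v)
    (by -- `⟪∂ᵥV, θ⟫` integrable
      show Integrable (fun x => ⟪fderiv ℝ V x v, θ x⟫) volume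
      exact ((hDVc.clm_apply continuous_const).inner hθ1).integrable_of_hasCompactSupport hs1)
    (by -- `⟪V, ∂ᵥθ⟫` integrable
      show Integrable (fun x => ⟪V x, fderiv ℝ θ x v⟫) volume
      exact (hVc.inner hDθ).integrable_of_hasCompactSupport hs2)
    (by -- `⟪V, θ⟫` integrable
      show Integrable (fun x => ⟪V x, θ x⟫) volume
      exact (hVc.inner hθ1).integrable_of_hasCompactSupport hs3)
    (fun x _ => (hC1.differentiable one_ne_zero x).hasFDerivAt)
    (fun x _ => (hθ.differentiable (by simp) x).hasFDerivAt)
  change ∫ x, ⟪V x, fderiv ℝ θ x v⟫ = -∫ x, ⟪fderiv ℝ V x v, θ x⟫ at key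
  rw [key]
  congr 1
  refine integral_congr_ae (Eventually.of_forall fun x => ?_)
  show ⟪fderiv ℝ V x v, θ x⟫ = _
  rw [hfd x, ContinuousLinearMap.integral_apply (hpt x).1 v]

/-- **Joint measurability of the forward Duhamel integral** `(t, x) ↦ ∫₀ᵗ e^{(t-s)Δ}G(s)(x) ds` for
jointly measurable `G` (Fubini measurability of a parametric integral). [folklore] -/
theorem measurable_duhamel_uncurry (hGm : Measurable (uncurry G)) :
    Measurable fun z : ℝ × E => ∫ s in Ioo 0 z.1, UnboundedOperators.heatExtension (G s) (z.1 - s) z.2 := by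
  have hHm := measurable_heatExtension_slice_sub hGm
  -- the integrand `((t,x), s) ↦ 1_{0<s<t} e^{(t-s)Δ}G(s)(x)`
  have hS : MeasurableSet {q : (ℝ × E) × ℝ | q.2 ∈ Ioo 0 q.1.1} := by
    have : {q : (ℝ × E) × ℝ | q.2 ∈ Ioo 0 q.1.1} = {q | 0 < q.2} ∩ {q | q.2 < q.1.1} := by
      ext q; simp [mem_Ioo]
    rw [this]
    exact (measurableSet_lt measurable_const measurable_snd).inter
      (measurableSet_lt measurable_snd measurable_fst.fst)
  have hF : Measurable fun q : (ℝ × E) × ℝ =>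
      UnboundedOperators.heatExtension (G q.2) (q.1.1 - q.2) q.1.2 := by
    have hg : Measurable fun q : (ℝ × E) × ℝ => ((q.2, q.1.1, q.1.2) : ℝ × ℝ × E) :=
      measurable_snd.prodMk (measurable_fst.fst.prodMk measurable_fst.snd)
    change Measurable ((fun p : ℝ × ℝ × E =>
      UnboundedOperators.heatExtension (G p.1) (p.2.1 - p.1) p.2.2) ∘ fun q : (ℝ × E) × ℝ => ((q.2, q.1.1, q.1.2) : ℝ × ℝ × E))
    exact hHm.comp hg
  have hI : StronglyMeasurable fun q : (ℝ × E) × ℝ =>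
      if q.2 ∈ Ioo 0 q.1.1 then UnboundedOperators.heatExtension (G q.2) (q.1.1 - q.2) q.1.2 else 0 :=
    (Measurable.ite hS hF measurable_const).stronglyMeasurable
  have key := hI.integral_prod_right' (ν := (volume : Measure ℝ))
  have heq : (fun z : ℝ × E => ∫ s in Ioo 0 z.1, UnboundedOperators.heatExtension (G s) (z.1 - s) z.2) =
      fun z : ℝ × E => ∫ s : ℝ, if (z, s).2 ∈ Ioo 0 (z, s).1.1 then
        UnboundedOperators.heatExtension (G (z, s).2) ((z, s).1.1 - (z, s).2) (z, s).1.2 else 0 := by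
    funext z
    rw [← integral_indicator measurableSet_Ioo]
    refine integral_congr_ae (Eventually.of_forall fun s => ?_)
    simp only [indicator_apply]
  rw [heq]
  exact key.measurable

/-- **Joint measurability of the derivative of the forward Duhamel integral**
`(t, x) ↦ ∫₀ᵗ ∂ᵥ(e^{(t-s)Δ}G(s))(x) ds` for jointly measurable bounded `G` (the derivatives of the
measurable family of smooth slices `e^{(t-s)Δ}G(s)` are jointly measurable,
`FunctionSpaces.stronglyMeasurable_fderiv_apply_param`, then Fubini measurability). [folklore] -/
theorem measurable_duhamel_fderiv_uncurry (hGm : Measurable (uncurry G)) (hGb : ∀ s x, ‖G s x‖ ≤ M) (v : E) :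
    Measurable fun z : ℝ × E =>
      ∫ s in Ioo 0 z.1, fderiv ℝ (UnboundedOperators.heatExtension (G s) (z.1 - s)) z.2 v := by
  haveI : CompleteSpace E := FiniteDimensional.complete ℝ E
  have hGs : ∀ s, Measurable (G s) := fun s => hGm.comp (measurable_const.prodMk measurable_id)
  have hHm := measurable_heatExtension_slice_sub hGm
  -- the family `W (s, t) = 1_{s<t} e^{(t-s)Δ}G(s)` with smooth slices
  set W : ℝ × ℝ → E → E := fun w => if w.1 < w.2 then UnboundedOperators.heatExtension (G w.1) (w.2 - w.1) else 0
    with hW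
  have hWsmooth : ∀ w, ContDiff ℝ ∞ (W w) := fun w => by
    by_cases hw : w.1 < w.2
    · simp only [hW, if_pos hw]
      exact (UnboundedOperators.contDiff_heatExtension_holds
        (memLp_top_of_bound (hGs w.1).aestronglyMeasurable M (Eventually.of_forall (hGb w.1))) le_top
        (sub_pos.2 hw)).of_le (by exact_mod_cast le_top)
    · simp only [hW, if_neg hw]; exact contDiff_const
  have hWm : StronglyMeasurable (uncurry W) := by
    have hS : MeasurableSet {q : (ℝ × ℝ) × E | q.1.1 < q.1.2} :=
      measurableSet_lt measurable_fst.fst measurable_fst.snd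
    have hF : Measurable fun q : (ℝ × ℝ) × E =>
        UnboundedOperators.heatExtension (G q.1.1) (q.1.2 - q.1.1) q.2 := by
      have hg : Measurable fun q : (ℝ × ℝ) × E => ((q.1.1, q.1.2, q.2) : ℝ × ℝ × E) :=
        measurable_fst.fst.prodMk (measurable_fst.snd.prodMk measurable_snd)
      change Measurable ((fun p : ℝ × ℝ × E =>
        UnboundedOperators.heatExtension (G p.1) (p.2.1 - p.1) p.2.2) ∘
          fun q : (ℝ × ℝ) × E => ((q.1.1, q.1.2, q.2) : ℝ × ℝ × E))
      exact hHm.comp hg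
    have heq : uncurry W = {q : (ℝ × ℝ) × E | q.1.1 < q.1.2}.piecewise
        (fun q => UnboundedOperators.heatExtension (G q.1.1) (q.1.2 - q.1.1) q.2) 0 := by
      funext q
      by_cases hq : q.1.1 < q.1.2
      · rw [piecewise_eq_of_mem _ _ _ (show q ∈ {q : (ℝ × ℝ) × E | q.1.1 < q.1.2} from hq)]
        show W q.1 q.2 = _; simp only [hW, if_pos hq]
      · rw [piecewise_eq_of_notMem _ _ _ (show q ∉ {q : (ℝ × ℝ) × E | q.1.1 < q.1.2} from hq)]
        show W q.1 q.2 = _; simp only [hW, if_neg hq]; rfl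
    rw [heq]
    exact hF.stronglyMeasurable.piecewise hS stronglyMeasurable_const
  have hDm : StronglyMeasurable (fun q : (ℝ × ℝ) × E => fderiv ℝ (W q.1) q.2 v) :=
    FunctionSpaces.stronglyMeasurable_fderiv_apply_param hWm
      (fun w x => ((hWsmooth w).differentiable (by simp)).differentiableAt) v
  -- the integrand `((t,x), s) ↦ 1_{0<s<t} ∂ᵥ(W (s,t))(x)`
  have hS : MeasurableSet {q : (ℝ × E) × ℝ | q.2 ∈ Ioo 0 q.1.1} := by
    have : {q : (ℝ × E) × ℝ | q.2 ∈ Ioo 0 q.1.1} = {q | 0 < q.2} ∩ {q | q.2 < q.1.1} := by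
      ext q; simp [mem_Ioo]
    rw [this]
    exact (measurableSet_lt measurable_const measurable_snd).inter
      (measurableSet_lt measurable_snd measurable_fst.fst)
  have hF : StronglyMeasurable fun q : (ℝ × E) × ℝ => fderiv ℝ (W (q.2, q.1.1)) q.1.2 v := by
    have hg : Measurable fun q : (ℝ × E) × ℝ => (((q.2, q.1.1), q.1.2) : (ℝ × ℝ) × E) :=
      (measurable_snd.prodMk measurable_fst.fst).prodMk measurable_fst.snd
    exact hDm.comp_measurable hg
  have hI : StronglyMeasurable fun q : (ℝ × E) × ℝ =>
      if q.2 ∈ Ioo 0 q.1.1 then fderiv ℝ (W (q.2, q.1.1)) q.1.2 v else 0 :=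
    hF.piecewise hS stronglyMeasurable_const
  have key := hI.integral_prod_right' (ν := (volume : Measure ℝ))
  have heq : (fun z : ℝ × E =>
      ∫ s in Ioo 0 z.1, fderiv ℝ (UnboundedOperators.heatExtension (G s) (z.1 - s)) z.2 v) =
      fun z : ℝ × E => ∫ s : ℝ, if (z, s).2 ∈ Ioo 0 (z, s).1.1 then
        fderiv ℝ (W ((z, s).2, (z, s).1.1)) (z, s).1.2 v else 0 := by
    funext z
    rw [← integral_indicator measurableSet_Ioo]
    refine integral_congr_ae (Eventually.of_forall fun s => ?_)
    simp only [indicator_apply]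
    by_cases hs : s ∈ Ioo 0 z.1
    · rw [if_pos hs, if_pos hs]
      simp only [hW, if_pos hs.2]
    · rw [if_neg hs, if_neg hs]
  rw [heq]
  exact key.measurable

/-- **Bounds of the forward Duhamel integral and of its derivative** for bounded data on `(0, T]`:
`‖∫₀ᵗ e^{(t-s)Δ}G(s)(x) ds‖ ≤ M T` and `‖∫₀ᵗ ∂ᵥ(e^{(t-s)Δ}G(s))(x) ds‖ ≤ 2·2^{dim/2} T^{1/2} M ‖v‖`
for `t ∈ (0, T)`. [folklore] -/
theorem norm_duhamel_le_and_norm_duhamel_fderiv_le (hGm : Measurable (uncurry G))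
    (hGb : ∀ s x, ‖G s x‖ ≤ M) {t : ℝ} (ht : t ∈ Ioo 0 T) (x v : E) :
    ‖∫ s in Ioo 0 t, UnboundedOperators.heatExtension (G s) (t - s) x‖ ≤ M * T ∧
    ‖∫ s in Ioo 0 t, fderiv ℝ (UnboundedOperators.heatExtension (G s) (t - s)) x v‖ ≤
      2 * (2 : ℝ) ^ ((Module.finrank ℝ E : ℝ) / 2) * T ^ (1 / 2 : ℝ) * M * ‖v‖ := by
  haveI : CompleteSpace E := FiniteDimensional.complete ℝ E
  have hM0 : 0 ≤ M := (norm_nonneg _).trans (hGb 0 0)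
  have hGs : ∀ s, Measurable (G s) := fun s => hGm.comp (measurable_const.prodMk measurable_id)
  set d2 : ℝ := (2 : ℝ) ^ ((Module.finrank ℝ E : ℝ) / 2) with hd2
  constructor
  · have h1 : ‖∫ s in Ioo 0 t, UnboundedOperators.heatExtension (G s) (t - s) x‖ ≤ M * (volume (Ioo 0 t)).toReal := by
      refine norm_setIntegral_le_of_norm_le_const measure_Ioo_lt_top (fun s hs => ?_)
      exact UnboundedOperators.norm_heatExtension_le (hGb s) (sub_pos.2 hs.2) x
    rw [Real.volume_Ioo, sub_zero, ENNReal.toReal_ofReal ht.1.le] at h1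
    exact h1.trans (mul_le_mul_of_nonneg_left ht.2.le hM0)
  · obtain ⟨hI, hIval⟩ := integrableOn_Ioo_sub_rpow_and_integral_eq (e := -(1 / 2 : ℝ)) ht.1 (by norm_num)
    have h1 : ‖∫ s in Ioo 0 t, fderiv ℝ (UnboundedOperators.heatExtension (G s) (t - s)) x v‖ ≤
        ∫ s in Ioo 0 t, d2 * M * ‖v‖ * (t - s) ^ (-(1 / 2 : ℝ)) := by
      refine norm_integral_le_of_norm_le (hI.const_mul _) ?_
      filter_upwards [ae_restrict_mem measurableSet_Ioo] with s hs
      have h := UnboundedOperators.norm_fderiv_heatExtension_apply_le_of_bounded (hGs s).aestronglyMeasurable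
        (hGb s) (sub_pos.2 hs.2) x v
      calc ‖fderiv ℝ (UnboundedOperators.heatExtension (G s) (t - s)) x v‖
          ≤ d2 * (t - s) ^ (-(1 / 2 : ℝ)) * M * ‖v‖ := h
        _ = d2 * M * ‖v‖ * (t - s) ^ (-(1 / 2 : ℝ)) := by ring
    refine h1.trans ?_
    rw [integral_const_mul, hIval, sub_zero]
    norm_num
    have ht12 : t ^ (1 / 2 : ℝ) ≤ T ^ (1 / 2 : ℝ) := Real.rpow_le_rpow ht.1.le ht.2.le (by norm_num)
    have : 0 ≤ d2 * M * ‖v‖ := by positivity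
    calc d2 * M * ‖v‖ * (t ^ (1 / 2 : ℝ) / (1 / 2)) = 2 * (d2 * M * ‖v‖) * t ^ (1 / 2 : ℝ) := by ring
      _ ≤ 2 * (d2 * M * ‖v‖) * T ^ (1 / 2 : ℝ) := by gcongr
      _ = 2 * d2 * T ^ (1 / 2 : ℝ) * M * ‖v‖ := by ring

/-- An integrand on the slab dominated by `C ‖Θ‖` with `Θ` a test field is integrable for the
restricted product measure, given measurability. [folklore] -/
theorem integrable_slab_of_norm_le_mul_test {Φ : ℝ × E → ℝ} {C : ℝ} (hT : 0 < T)
    (hΘ : IsSpaceTimeTestOn (slab E (Ioo 0 T) isOpen_Ioo) Θ)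
    (hΦm : AEStronglyMeasurable Φ (((volume : Measure ℝ).restrict (Ioo 0 T)).prod (volume : Measure E)))
    (hΦb : ∀ z : ℝ × E, z.1 ∈ Ioo 0 T → ‖Φ z‖ ≤ C * ‖Θ z.1 z.2‖) :
    Integrable Φ (((volume : Measure ℝ).restrict (Ioo 0 T)).prod (volume : Measure E)) := by
  obtain ⟨-, -, -, -, hΘi⟩ := hΘ.slab_data hT
  have hI : ∀ᵐ z ∂(((volume : Measure ℝ).restrict (Ioo 0 T)).prod (volume : Measure E)), z.1 ∈ Ioo 0 T :=
    (Measure.quasiMeasurePreserving_fst (μ := (volume : Measure ℝ).restrict (Ioo 0 T))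
      (ν := (volume : Measure E))).ae (ae_restrict_mem measurableSet_Ioo)
  refine Integrable.mono' ((hΘi.norm.const_mul C).mono_measure
    (Measure.prod_mono Measure.restrict_le_self le_rfl)) hΦm ?_
  filter_upwards [hI] with z hz
  exact hΦb z hz

/-- **The gradient term of the duality identity as a slab pairing with the forward
heat-gradient Duhamel integral.** For a bounded jointly measurable field `G` vanishing off a
compact set, a space–time test field `Θ` on `(0, T) × E` and a direction `v`,
`∫∫_{(0,T)×E} ⟪G, ∂ᵥ𝒰[Θ]⟫ = -∫∫_{(0,T)×E} ⟪∫₀ᵗ ∂ᵥ(e^{(t-s)Δ}G(s)) ds, Θ(t)⟫`: `∂ᵥ𝒰[Θ] = 𝒰[∂ᵥΘ]`,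
the forcing identity for the test field `∂ᵥΘ`, and an integration by parts in space on every
slice (Lemarié-Rieusset 2016, Prop. 4.3; the derivative is carried by the kernel, as in the
term `u₁ = ∫₀ᵗ e^{Δ(t-s)}[-div(u ⊗ uη) - ∇(pη)] ds` of Jia–Šverák's proof of Thm. 3.2). [cite: LemarieRieusset2016, Prop. 4.3 pp. 74–75] -/
theorem setIntegral_inner_fderiv_heatDuhamelBack_eq (hGm : Measurable (uncurry G))
    (hGb : ∀ s x, ‖G s x‖ ≤ M) (hKc : IsCompact K) (hGK : ∀ s x, x ∉ K → G s x = 0) (hT : 0 < T)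
    (hΘ : IsSpaceTimeTestOn (slab E (Ioo 0 T) isOpen_Ioo) Θ) (v : E) :
    ∫ z in Ioo 0 T ×ˢ (univ : Set E), ⟪G z.1 z.2, fderiv ℝ (heatDuhamelBack 1 Θ z.1) z.2 v⟫ =
      -∫ z in Ioo 0 T ×ˢ (univ : Set E),
        ⟪(∫ s in Ioo 0 z.1, fderiv ℝ (UnboundedOperators.heatExtension (G s) (z.1 - s)) z.2 v), Θ z.1 z.2⟫ := by
  haveI : CompleteSpace E := FiniteDimensional.complete ℝ E
  have hΘ' : IsSpaceTimeTestOn (⊤ : Opens (ℝ × E)) Θ := hΘ.mono le_top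
  have hM0 : 0 ≤ M := (norm_nonneg _).trans (hGb 0 0)
  -- `∂ᵥ𝒰[Θ] = 𝒰[∂ᵥΘ]`, a test field on the slab
  set Θv : ℝ → E → E := fun t y => fderiv ℝ (Θ t) y v with hΘv
  have hΘvtest : IsSpaceTimeTestOn (slab E (Ioo 0 T) isOpen_Ioo) Θv := hΘ.fderiv_apply_slice v
  have h1 : ∫ z in Ioo 0 T ×ˢ (univ : Set E), ⟪G z.1 z.2, fderiv ℝ (heatDuhamelBack 1 Θ z.1) z.2 v⟫ =
      ∫ z in Ioo 0 T ×ˢ (univ : Set E), ⟪G z.1 z.2, heatDuhamelBack 1 Θv z.1 z.2⟫ := by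
    refine setIntegral_congr_fun (measurableSet_Ioo.prod MeasurableSet.univ) fun z _ => ?_
    rw [hΘ'.fderiv_heatDuhamelBack_apply one_pos z.1 z.2 v]
  rw [h1, setIntegral_inner_heatDuhamelBack_eq hGm hGb hKc hGK hT hΘvtest]
  -- both sides as iterated integrals
  set V : ℝ × E → E := fun z => ∫ s in Ioo 0 z.1, UnboundedOperators.heatExtension (G s) (z.1 - s) z.2 with hV
  set V' : ℝ × E → E := fun z =>
    ∫ s in Ioo 0 z.1, fderiv ℝ (UnboundedOperators.heatExtension (G s) (z.1 - s)) z.2 v with hV'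
  have hVm : Measurable V := measurable_duhamel_uncurry hGm
  have hV'm : Measurable V' := measurable_duhamel_fderiv_uncurry hGm hGb v
  have hbd := fun (t : ℝ) (ht : t ∈ Ioo 0 T) (x : E) => norm_duhamel_le_and_norm_duhamel_fderiv_le hGm hGb ht x v
  set C' : ℝ := 2 * (2 : ℝ) ^ ((Module.finrank ℝ E : ℝ) / 2) * T ^ (1 / 2 : ℝ) * M * ‖v‖ with hC'
  have hintL : Integrable (fun z : ℝ × E => ⟪V z, Θv z.1 z.2⟫)
      (((volume : Measure ℝ).restrict (Ioo 0 T)).prod (volume : Measure E)) := by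
    refine integrable_slab_of_norm_le_mul_test (C := M * T) hT hΘvtest
      (hVm.aestronglyMeasurable.inner (hΘvtest.mono le_top).contDiff.continuous.aestronglyMeasurable) ?_
    intro z hz
    exact (norm_inner_le_norm _ _).trans (mul_le_mul_of_nonneg_right (hbd z.1 hz z.2).1 (norm_nonneg _))
  have hintR : Integrable (fun z : ℝ × E => ⟪V' z, Θ z.1 z.2⟫)
      (((volume : Measure ℝ).restrict (Ioo 0 T)).prod (volume : Measure E)) := by
    refine integrable_slab_of_norm_le_mul_test (C := C') hT hΘ
      (hV'm.aestronglyMeasurable.inner hΘ'.contDiff.continuous.aestronglyMeasurable) ?_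
    intro z hz
    exact (norm_inner_le_norm _ _).trans (mul_le_mul_of_nonneg_right (hbd z.1 hz z.2).2 (norm_nonneg _))
  have eL : ∫ z in Ioo 0 T ×ˢ (univ : Set E), ⟪V z, Θv z.1 z.2⟫ = ∫ t in Ioo 0 T, ∫ x, ⟪V (t, x), Θv t x⟫ := by
    rw [volume_restrict_Ioo_prod_univ, integral_prod _ hintL]
  have eR : ∫ z in Ioo 0 T ×ˢ (univ : Set E), ⟪V' z, Θ z.1 z.2⟫ = ∫ t in Ioo 0 T, ∫ x, ⟪V' (t, x), Θ t x⟫ := by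
    rw [volume_restrict_Ioo_prod_univ, integral_prod _ hintR]
  change ∫ z in Ioo 0 T ×ˢ (univ : Set E), ⟪V z, Θv z.1 z.2⟫ = -∫ z in Ioo 0 T ×ˢ (univ : Set E), ⟪V' z, Θ z.1 z.2⟫
  rw [eL, eR, ← integral_neg]
  -- integration by parts on every slice
  refine setIntegral_congr_fun measurableSet_Ioo fun t ht => ?_
  exact integral_inner_duhamel_fderiv_test_eq_neg hGm hGb ht.1 (hΘ'.contDiff_slice t)
    (hΘ'.hasCompactSupport_slice t) v

end Gradient

/-! ### The representation: `W = e^{tΔ}W₀ + ∫₀ᵗ e^{(t-s)Δ}G₀ ds - Σⱼ ∫₀ᵗ ∂_{bⱼ}e^{(t-s)Δ}G₁ⱼ ds` a.e. -/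

section Representation

variable {ι : Type*} [Fintype ι] {T M : ℝ} {W : ℝ → E → E} {W₀ : E → E} {G₀ : ℝ → E → E}
  {G₁ : ι → ℝ → E → E} {b : ι → E} {K : Set E}

/-- A bounded jointly measurable field vanishing off a compact set in space is integrable on the
slab `(0, T) × E`. [folklore] -/
theorem integrable_slab_of_bounded_of_support {G : ℝ → E → E} (hGm : Measurable (uncurry G))
    (hGb : ∀ s x, ‖G s x‖ ≤ M) (hKc : IsCompact K) (hGK : ∀ s x, x ∉ K → G s x = 0) (T : ℝ) :
    Integrable (uncurry G) ((volume : Measure (ℝ × E)).restrict (Ioo 0 T ×ˢ (univ : Set E))) := by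
  have hM0 : 0 ≤ M := (norm_nonneg _).trans (hGb 0 0)
  have hfin : (volume : Measure (ℝ × E)) (Ioo 0 T ×ˢ K) ≠ ⊤ := by
    rw [Measure.volume_eq_prod, Measure.prod_prod]
    exact ENNReal.mul_ne_top measure_Ioo_lt_top.ne hKc.measure_lt_top.ne
  have hind : Integrable ((Ioo 0 T ×ˢ K).indicator fun _ : ℝ × E => M) (volume : Measure (ℝ × E)) :=
    (integrableOn_const (C := M) hfin).integrable_indicator (measurableSet_Ioo.prod hKc.measurableSet)
  refine Integrable.mono' (hind.mono_measure Measure.restrict_le_self) hGm.aestronglyMeasurable ?_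
  filter_upwards [ae_restrict_mem (measurableSet_Ioo.prod MeasurableSet.univ)] with z hz
  by_cases hx : z.2 ∈ K
  · rw [indicator_of_mem (show z ∈ Ioo 0 T ×ˢ K from ⟨hz.1, hx⟩)]; exact hGb z.1 z.2
  · simp only [uncurry]
    rw [hGK z.1 z.2 hx, norm_zero]; exact indicator_nonneg (fun _ _ => hM0) _

/-- **The localised heat-mild representation from the weak forced heat identity with datum.**
Let `W, G₀, G₁ j : ℝ → E → E` be jointly measurable and bounded, `W₀ : E → E` measurable and
bounded, all vanishing for `x` outside a compact set `K`, and suppose the weak identity `(WH)`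
`∫∫_{(0,T)×E} (⟪W, ∂ₜΨ⟫ + ⟪W, ΔΨ⟫ + ⟪G₀, Ψ⟫ + Σⱼ ⟪G₁ j, ∂_{bⱼ}Ψ⟫) + ∫ ⟪W₀, Ψ(0)⟫ = 0` for every
space–time test field `Ψ` on `(-∞, T) × E`. Then for a.e. `(t, x) ∈ (0, T) × E`,
`W(t, x) = e^{tΔ}W₀(x) + ∫₀ᵗ e^{(t-s)Δ}G₀(s)(x) ds - Σⱼ ∫₀ᵗ ∂_{bⱼ}(e^{(t-s)Δ}G₁ j(s))(x) ds`
(the caloric duality identity with the three passages — datum, forcing, gradient — tested with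
`Θ = g • c`, and du Bois-Reymond on the open slab). This is the tree's form of the decomposition
`u = u₁ + u₂ + u₃` of the localised velocity in Jia–Šverák 2014, proof of Thm. 3.2 (arXiv p. 9:
`u₁ = ∫₀ᵗ e^{Δ(t-s)}[-div(u ⊗ uη) - ∇(pη)] ds`, `u₂ = e^{Δt}(u₀η)`), with the cut-off inside the
field so that no caloric remainder `u₃` appears. [cite: JiaSverak2014, §3 proof of Thm. 3.2 (the decomposition u = u₁ + u₂ + u₃), arXiv:1204.0529 p. 9] -/
theorem ae_eq_heatMild_of_weakHeat (hT : 0 < T) (hKc : IsCompact K)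
    (hWm : Measurable (uncurry W)) (hG₀m : Measurable (uncurry G₀))
    (hG₁m : ∀ j, Measurable (uncurry (G₁ j))) (hW₀m : Measurable W₀)
    (hWb : ∀ t x, ‖W t x‖ ≤ M) (hG₀b : ∀ t x, ‖G₀ t x‖ ≤ M) (hG₁b : ∀ j t x, ‖G₁ j t x‖ ≤ M)
    (hW₀b : ∀ x, ‖W₀ x‖ ≤ M)
    (hWK : ∀ t x, x ∉ K → W t x = 0) (hG₀K : ∀ t x, x ∉ K → G₀ t x = 0)
    (hG₁K : ∀ j t x, x ∉ K → G₁ j t x = 0) (hW₀K : ∀ x, x ∉ K → W₀ x = 0)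
    (hWH : ∀ Ψ : ℝ → E → E, IsSpaceTimeTestOn (slab E (Iio T) isOpen_Iio) Ψ →
      (∫ z in Ioo 0 T ×ˢ (univ : Set E), (⟪W z.1 z.2, timeDeriv Ψ z.1 z.2⟫ +
        ⟪W z.1 z.2, Δ (Ψ z.1) z.2⟫ + ⟪G₀ z.1 z.2, Ψ z.1 z.2⟫ +
        ∑ j, ⟪G₁ j z.1 z.2, fderiv ℝ (Ψ z.1) z.2 (b j)⟫)) + ∫ x, ⟪W₀ x, Ψ 0 x⟫ = 0) :
    ∀ᵐ z ∂((volume : Measure (ℝ × E)).restrict (Ioo 0 T ×ˢ (univ : Set E))),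
      W z.1 z.2 = UnboundedOperators.heatExtension W₀ z.1 z.2 +
        (∫ s in Ioo 0 z.1, UnboundedOperators.heatExtension (G₀ s) (z.1 - s) z.2) -
        ∑ j, ∫ s in Ioo 0 z.1,
          fderiv ℝ (UnboundedOperators.heatExtension (G₁ j s) (z.1 - s)) z.2 (b j) := by
  haveI : CompleteSpace E := FiniteDimensional.complete ℝ E
  have hM0 : 0 ≤ M := (norm_nonneg _).trans (hW₀b 0)
  -- the candidate
  set R : ℝ × E → E := fun z => UnboundedOperators.heatExtension W₀ z.1 z.2 +
    (∫ s in Ioo 0 z.1, UnboundedOperators.heatExtension (G₀ s) (z.1 - s) z.2) -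
    ∑ j, ∫ s in Ioo 0 z.1, fderiv ℝ (UnboundedOperators.heatExtension (G₁ j s) (z.1 - s)) z.2 (b j)
    with hR
  -- measurability of the candidate
  have hmW₀ : Measurable fun q : ℝ × E => UnboundedOperators.heatExtension W₀ q.1 q.2 := by
    have hg : Measurable fun q : ℝ × E => (((0 : ℝ), q.1, q.2) : ℝ × ℝ × E) :=
      measurable_const.prodMk (measurable_fst.prodMk measurable_snd)
    change Measurable ((fun p : ℝ × ℝ × E =>
      UnboundedOperators.heatExtension ((fun _ : ℝ => W₀) p.1) p.2.1 p.2.2) ∘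
        fun q : ℝ × E => (((0 : ℝ), q.1, q.2) : ℝ × ℝ × E))
    exact (measurable_heatExtension_slice (z := fun _ : ℝ => W₀) (hW₀m.comp measurable_snd)).comp hg
  have hRm : Measurable R := by
    refine (hmW₀.add (measurable_duhamel_uncurry hG₀m)).sub ?_
    exact Finset.measurable_sum _ fun j _ => measurable_duhamel_fderiv_uncurry (hG₁m j) (hG₁b j) (b j)
  -- bound of the candidate on the slab
  set C₁ : ℝ := 2 * (2 : ℝ) ^ ((Module.finrank ℝ E : ℝ) / 2) * T ^ (1 / 2 : ℝ) * M with hC₁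
  have hC₁0 : 0 ≤ C₁ := by positivity
  have hRb : ∀ z : ℝ × E, z.1 ∈ Ioo 0 T → ‖R z‖ ≤ M + M * T + ∑ j, C₁ * ‖b j‖ := by
    intro z hz
    have h0 : ‖UnboundedOperators.heatExtension W₀ z.1 z.2‖ ≤ M :=
      UnboundedOperators.norm_heatExtension_le hW₀b hz.1 z.2
    have h1 := (norm_duhamel_le_and_norm_duhamel_fderiv_le hG₀m hG₀b hz z.2 0).1
    have h2 : ∀ j, ‖∫ s in Ioo 0 z.1,
        fderiv ℝ (UnboundedOperators.heatExtension (G₁ j s) (z.1 - s)) z.2 (b j)‖ ≤ C₁ * ‖b j‖ :=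
      fun j => (norm_duhamel_le_and_norm_duhamel_fderiv_le (hG₁m j) (hG₁b j) hz z.2 (b j)).2
    calc ‖R z‖ ≤ ‖UnboundedOperators.heatExtension W₀ z.1 z.2 +
          (∫ s in Ioo 0 z.1, UnboundedOperators.heatExtension (G₀ s) (z.1 - s) z.2)‖ +
          ‖∑ j, ∫ s in Ioo 0 z.1,
            fderiv ℝ (UnboundedOperators.heatExtension (G₁ j s) (z.1 - s)) z.2 (b j)‖ := norm_sub_le _ _
      _ ≤ (M + M * T) + ∑ j, C₁ * ‖b j‖ :=
          add_le_add ((norm_add_le _ _).trans (add_le_add h0 h1))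
            ((norm_sum_le _ _).trans (Finset.sum_le_sum fun j _ => h2 j))
  -- integrability of the data on the slab, for the duality identity
  have hWi := integrable_slab_of_bounded_of_support hWm hWb hKc hWK T
  have hG₀i := integrable_slab_of_bounded_of_support hG₀m hG₀b hKc hG₀K T
  have hG₁i := fun j => integrable_slab_of_bounded_of_support (hG₁m j) (hG₁b j) hKc (hG₁K j) T
  have hW₀i : Integrable W₀ volume := by
    refine Integrable.mono' ((integrableOn_const (C := M) (hKc.measure_lt_top).ne).integrable_indicator
      hKc.measurableSet) hW₀m.aestronglyMeasurable (Eventually.of_forall fun x => ?_)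
    by_cases hx : x ∈ K
    · rw [indicator_of_mem hx]; exact hW₀b x
    · rw [hW₀K x hx, norm_zero, indicator_of_notMem hx]
  -- ### the tested identity `∫∫ ⟪W - R, Θ⟫ = 0` for every test field `Θ` on the open slab
  have htested : ∀ Θ : ℝ → E → E, IsSpaceTimeTestOn (slab E (Ioo 0 T) isOpen_Ioo) Θ →
      ∫ z in Ioo 0 T ×ˢ (univ : Set E), ⟪W z.1 z.2 - R z, Θ z.1 z.2⟫ = 0 := by
    intro Θ hΘ
    have hΘ' : IsSpaceTimeTestOn (⊤ : Opens (ℝ × E)) Θ := hΘ.mono le_top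
    have hΘIio : IsSpaceTimeTestOn (slab E (Iio T) isOpen_Iio) Θ :=
      hΘ.mono (slab_mono (fun t ht => ht.2))
    -- duality identity and the three passages
    have hD := duality_identity_of_weakHeat hT hKc hWi hG₀i hG₁i hWK hG₀K hG₁K hW₀K hWH hΘIio
    have hPa := integral_inner_heatDuhamelBack_zero_eq hW₀m hW₀b hW₀i hT hΘ
    have hPb := setIntegral_inner_heatDuhamelBack_eq hG₀m hG₀b hKc hG₀K hT hΘ
    have hPc := fun j => setIntegral_inner_fderiv_heatDuhamelBack_eq (hG₁m j) (hG₁b j) hKc (hG₁K j) hT hΘ (b j)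
    -- integrability of the pairings with `Θ` on the slab (restricted product measure form)
    have hμ := volume_restrict_Ioo_prod_univ (E := E) T
    have hΘc : Continuous (uncurry Θ) := hΘ'.contDiff.continuous
    have hΘm : AEStronglyMeasurable (uncurry Θ)
        (((volume : Measure ℝ).restrict (Ioo 0 T)).prod (volume : Measure E)) := hΘc.aestronglyMeasurable
    have h𝒰c : Continuous (uncurry (heatDuhamelBack 1 Θ)) := hΘ'.continuous_heatDuhamelBack one_pos
    have iW : Integrable (fun z : ℝ × E => ⟪W z.1 z.2, Θ z.1 z.2⟫)
        (((volume : Measure ℝ).restrict (Ioo 0 T)).prod (volume : Measure E)) :=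
      integrable_slab_of_norm_le_mul_test (C := M) hT hΘ (hWm.aestronglyMeasurable.inner hΘm)
        fun z _ => (norm_inner_le_norm _ _).trans (mul_le_mul_of_nonneg_right (hWb z.1 z.2) (norm_nonneg _))
    have iR : Integrable (fun z : ℝ × E => ⟪R z, Θ z.1 z.2⟫)
        (((volume : Measure ℝ).restrict (Ioo 0 T)).prod (volume : Measure E)) :=
      integrable_slab_of_norm_le_mul_test (C := M + M * T + ∑ j, C₁ * ‖b j‖) hT hΘ
        (hRm.aestronglyMeasurable.inner hΘm)
        fun z hz => (norm_inner_le_norm _ _).trans (mul_le_mul_of_nonneg_right (hRb z hz) (norm_nonneg _))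
    have i0 : Integrable (fun z : ℝ × E => ⟪UnboundedOperators.heatExtension W₀ z.1 z.2, Θ z.1 z.2⟫)
        (((volume : Measure ℝ).restrict (Ioo 0 T)).prod (volume : Measure E)) :=
      integrable_slab_of_norm_le_mul_test (C := M) hT hΘ (hmW₀.aestronglyMeasurable.inner hΘm)
        fun z hz => (norm_inner_le_norm _ _).trans (mul_le_mul_of_nonneg_right
          (UnboundedOperators.norm_heatExtension_le hW₀b hz.1 z.2) (norm_nonneg _))
    have i1 : Integrable (fun z : ℝ × E =>
        ⟪(∫ s in Ioo 0 z.1, UnboundedOperators.heatExtension (G₀ s) (z.1 - s) z.2), Θ z.1 z.2⟫)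
        (((volume : Measure ℝ).restrict (Ioo 0 T)).prod (volume : Measure E)) :=
      integrable_slab_of_norm_le_mul_test (C := M * T) hT hΘ
        ((measurable_duhamel_uncurry hG₀m).aestronglyMeasurable.inner hΘm)
        fun z hz => (norm_inner_le_norm _ _).trans (mul_le_mul_of_nonneg_right
          (norm_duhamel_le_and_norm_duhamel_fderiv_le hG₀m hG₀b hz z.2 0).1 (norm_nonneg _))
    have i2 : ∀ j, Integrable (fun z : ℝ × E =>
        ⟪(∫ s in Ioo 0 z.1, fderiv ℝ (UnboundedOperators.heatExtension (G₁ j s) (z.1 - s)) z.2 (b j)),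
          Θ z.1 z.2⟫)
        (((volume : Measure ℝ).restrict (Ioo 0 T)).prod (volume : Measure E)) := fun j =>
      integrable_slab_of_norm_le_mul_test (C := C₁ * ‖b j‖) hT hΘ
        ((measurable_duhamel_fderiv_uncurry (hG₁m j) (hG₁b j) (b j)).aestronglyMeasurable.inner hΘm)
        fun z hz => (norm_inner_le_norm _ _).trans (mul_le_mul_of_nonneg_right
          (norm_duhamel_le_and_norm_duhamel_fderiv_le (hG₁m j) (hG₁b j) hz z.2 (b j)).2 (norm_nonneg _))
    -- the `G₀`/`G₁` part of the duality identity splits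
    have hMΘ := hΘ'.exists_norm_le
    obtain ⟨MΘ, hMΘ0, hMΘ⟩ := hMΘ
    have iB0 : Integrable (fun z : ℝ × E => ⟪G₀ z.1 z.2, heatDuhamelBack 1 Θ z.1 z.2⟫)
        ((volume : Measure (ℝ × E)).restrict (Ioo 0 T ×ˢ (univ : Set E))) := by
      obtain ⟨a, b', hab⟩ := hΘ'.exists_time_support
      have hI : ∀ᵐ z ∂((volume : Measure (ℝ × E)).restrict (Ioo 0 T ×ˢ (univ : Set E))), z.1 ∈ Ioo 0 T := by
        filter_upwards [ae_restrict_mem (measurableSet_Ioo.prod MeasurableSet.univ)] with z hz; exact hz.1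
      refine (hG₀i.norm.mul_const (MΘ * (|b'| + |T|))).mono' (hG₀i.1.inner h𝒰c.aestronglyMeasurable) ?_
      filter_upwards [hI] with z hz
      refine (norm_inner_le_norm _ _).trans (mul_le_mul_of_nonneg_left ?_ (norm_nonneg _))
      refine (hΘ'.norm_heatDuhamelBack_le one_pos hMΘ hab z.1 z.2).trans (mul_le_mul_of_nonneg_left ?_ hMΘ0)
      refine max_le ?_ (by positivity)
      have : |z.1| ≤ |T| := by rw [abs_of_pos hz.1]; exact hz.2.le.trans (le_abs_self T)
      linarith [le_abs_self b', neg_abs_le z.1]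
    have iB1 : ∀ j, Integrable (fun z : ℝ × E =>
        ⟪G₁ j z.1 z.2, fderiv ℝ (heatDuhamelBack 1 Θ z.1) z.2 (b j)⟫)
        ((volume : Measure (ℝ × E)).restrict (Ioo 0 T ×ˢ (univ : Set E))) := fun j => by
      have hΘv := hΘ'.fderiv_apply_top (b j)
      obtain ⟨Mv, hMv0, hMv⟩ := hΘv.exists_norm_le
      obtain ⟨a, b', hab⟩ := hΘv.exists_time_support
      have hcont : Continuous (uncurry fun s x => fderiv ℝ (heatDuhamelBack 1 Θ s) x (b j)) := by
        refine (hΘv.continuous_heatDuhamelBack one_pos).congr fun z => ?_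
        simp only [uncurry]; rw [hΘ'.fderiv_heatDuhamelBack_apply one_pos]
      have hI : ∀ᵐ z ∂((volume : Measure (ℝ × E)).restrict (Ioo 0 T ×ˢ (univ : Set E))), z.1 ∈ Ioo 0 T := by
        filter_upwards [ae_restrict_mem (measurableSet_Ioo.prod MeasurableSet.univ)] with z hz; exact hz.1
      refine ((hG₁i j).norm.mul_const (Mv * (|b'| + |T|))).mono' ((hG₁i j).1.inner hcont.aestronglyMeasurable) ?_
      filter_upwards [hI] with z hz
      refine (norm_inner_le_norm _ _).trans (mul_le_mul_of_nonneg_left ?_ (norm_nonneg _))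
      rw [hΘ'.fderiv_heatDuhamelBack_apply one_pos]
      refine (hΘv.norm_heatDuhamelBack_le one_pos hMv hab z.1 z.2).trans (mul_le_mul_of_nonneg_left ?_ hMv0)
      refine max_le ?_ (by positivity)
      have : |z.1| ≤ |T| := by rw [abs_of_pos hz.1]; exact hz.2.le.trans (le_abs_self T)
      linarith [le_abs_self b', neg_abs_le z.1]
    have hsplit : ∫ z in Ioo 0 T ×ˢ (univ : Set E), (⟪G₀ z.1 z.2, heatDuhamelBack 1 Θ z.1 z.2⟫ +
        ∑ j, ⟪G₁ j z.1 z.2, fderiv ℝ (heatDuhamelBack 1 Θ z.1) z.2 (b j)⟫) =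
        (∫ z in Ioo 0 T ×ˢ (univ : Set E), ⟪G₀ z.1 z.2, heatDuhamelBack 1 Θ z.1 z.2⟫) +
        ∑ j, ∫ z in Ioo 0 T ×ˢ (univ : Set E), ⟪G₁ j z.1 z.2, fderiv ℝ (heatDuhamelBack 1 Θ z.1) z.2 (b j)⟫ := by
      rw [integral_add iB0 (integrable_finsetSum _ fun j _ => iB1 j), integral_finsetSum _ fun j _ => iB1 j]
    -- assemble: `∫∫ ⟪W, Θ⟫ = ∫∫ ⟪R, Θ⟫`
    have hWR : ∫ z in Ioo 0 T ×ˢ (univ : Set E), ⟪W z.1 z.2, Θ z.1 z.2⟫ =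
        ∫ z in Ioo 0 T ×ˢ (univ : Set E), ⟪R z, Θ z.1 z.2⟫ := by
      rw [hD, hsplit, hPa, hPb]
      simp_rw [hPc]
      -- the right-hand side pairing, expanded
      have eR : ∀ z : ℝ × E, ⟪R z, Θ z.1 z.2⟫ =
          ⟪UnboundedOperators.heatExtension W₀ z.1 z.2, Θ z.1 z.2⟫ +
          ⟪(∫ s in Ioo 0 z.1, UnboundedOperators.heatExtension (G₀ s) (z.1 - s) z.2), Θ z.1 z.2⟫ +
          ∑ j, -⟪(∫ s in Ioo 0 z.1,
            fderiv ℝ (UnboundedOperators.heatExtension (G₁ j s) (z.1 - s)) z.2 (b j)), Θ z.1 z.2⟫ := by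
        intro z
        simp only [hR, inner_sub_left, inner_add_left, sum_inner, Finset.sum_neg_distrib]
        ring
      simp_rw [eR]
      have i01 : Integrable (fun z : ℝ × E =>
          ⟪UnboundedOperators.heatExtension W₀ z.1 z.2, Θ z.1 z.2⟫ +
          ⟪(∫ s in Ioo 0 z.1, UnboundedOperators.heatExtension (G₀ s) (z.1 - s) z.2), Θ z.1 z.2⟫)
          (((volume : Measure ℝ).restrict (Ioo 0 T)).prod (volume : Measure E)) := i0.add i1
      have i2n : ∀ j, Integrable (fun z : ℝ × E => -⟪(∫ s in Ioo 0 z.1,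
            fderiv ℝ (UnboundedOperators.heatExtension (G₁ j s) (z.1 - s)) z.2 (b j)), Θ z.1 z.2⟫)
          (((volume : Measure ℝ).restrict (Ioo 0 T)).prod (volume : Measure E)) := fun j => (i2 j).neg
      have i2s : Integrable (fun z : ℝ × E => ∑ j, -⟪(∫ s in Ioo 0 z.1,
            fderiv ℝ (UnboundedOperators.heatExtension (G₁ j s) (z.1 - s)) z.2 (b j)), Θ z.1 z.2⟫)
          (((volume : Measure ℝ).restrict (Ioo 0 T)).prod (volume : Measure E)) :=
        integrable_finsetSum _ fun j _ => i2n j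
      rw [hμ, integral_add i01 i2s, integral_add i0 i1, integral_finsetSum _ fun j _ => i2n j]
      simp_rw [integral_neg]
      ring
    simp_rw [inner_sub_left]
    rw [hμ, integral_sub iW iR, sub_eq_zero]
    rw [hμ] at hWR
    exact hWR
  -- ### du Bois-Reymond on the open slab
  set f : ℝ × E → E := fun z => W z.1 z.2 - R z with hf
  have hU : IsOpen (Ioo 0 T ×ˢ (univ : Set E)) := isOpen_Ioo.prod isOpen_univ
  have hfm : Measurable f := hWm.sub hRm
  have hfb : ∀ z : ℝ × E, z.1 ∈ Ioo 0 T → ‖f z‖ ≤ M + (M + M * T + ∑ j, C₁ * ‖b j‖) := fun z hz =>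
    (norm_sub_le _ _).trans (add_le_add (hWb z.1 z.2) (hRb z hz))
  have hfli : LocallyIntegrableOn f (Ioo 0 T ×ˢ (univ : Set E)) (volume : Measure (ℝ × E)) := by
    intro z hz
    refine ⟨(Ioo 0 T ×ˢ (univ : Set E)) ∩ ball z 1, inter_mem_nhdsWithin _ (ball_mem_nhds z one_pos), ?_⟩
    have hfin : (volume : Measure (ℝ × E)) ((Ioo 0 T ×ˢ (univ : Set E)) ∩ ball z 1) ≠ ⊤ :=
      ne_top_of_le_ne_top measure_ball_lt_top.ne (measure_mono inter_subset_right)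
    refine Integrable.mono' (integrableOn_const (C := M + (M + M * T + ∑ j, C₁ * ‖b j‖)) hfin)
      hfm.aestronglyMeasurable ?_
    filter_upwards [ae_restrict_mem ((measurableSet_Ioo.prod MeasurableSet.univ).inter measurableSet_ball)]
      with w hw
    exact hfb w hw.1.1
  have hzero : ∀ g : ℝ × E → ℝ, ContDiff ℝ ∞ g → HasCompactSupport g →
      tsupport g ⊆ Ioo 0 T ×ˢ (univ : Set E) → ∫ z, g z • f z = 0 := by
    intro g hg hgc hgs
    -- the integral over `E × ℝ` is the integral over the slab, and is integrable there
    have hgi : Integrable (fun z => g z • f z) (volume : Measure (ℝ × E)) := by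
      obtain ⟨Mg, hMg⟩ := (hg.continuous.norm).bddAbove_range_of_hasCompactSupport hgc.norm
      have hMg' : ∀ z, ‖g z‖ ≤ Mg := fun z => hMg ⟨z, rfl⟩
      refine Integrable.mono' ((hg.continuous.integrable_of_hasCompactSupport hgc).norm.mul_const
        (M + (M + M * T + ∑ j, C₁ * ‖b j‖))) (hg.continuous.aestronglyMeasurable.smul hfm.aestronglyMeasurable) ?_
      refine Eventually.of_forall fun z => ?_
      by_cases hz : z ∈ tsupport g
      · rw [norm_smul]
        exact mul_le_mul_of_nonneg_left (hfb z (hgs hz).1) (norm_nonneg _)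
      · rw [image_eq_zero_of_notMem_tsupport hz, zero_smul, norm_zero, norm_zero, zero_mul]
    refine integral_eq_zero_of_forall_integral_inner_eq_zero ℝ _ hgi fun c => ?_
    -- test with `Θ = g • c`
    set Θ : ℝ → E → E := fun t x => g (t, x) • c with hΘdef
    have hΘeq : uncurry Θ = g • fun _ : ℝ × E => c := by funext z; rfl
    have hΘtest : IsSpaceTimeTestOn (slab E (Ioo 0 T) isOpen_Ioo) Θ := by
      refine ⟨?_, ?_, ?_⟩
      · rw [hΘeq]; exact hg.smul contDiff_const
      · rw [hΘeq]; exact hgc.smul_right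
      · rw [hΘeq]; exact (tsupport_smul_subset_left _ _).trans hgs
    have h := htested Θ hΘtest
    -- `⟪f, g • c⟫ = ⟪c, g • f⟫`
    have e1 : ∀ z : ℝ × E, ⟪W z.1 z.2 - R z, Θ z.1 z.2⟫ = ⟪c, g z • f z⟫ := fun z => by
      simp only [hΘdef, hf, inner_smul_right, inner_smul_right, real_inner_comm]
    simp_rw [e1] at h
    rw [← setIntegral_eq_integral_of_forall_compl_eq_zero (s := Ioo 0 T ×ˢ (univ : Set E)) fun z hz => ?_]
    · exact h
    · have : g z = 0 := image_eq_zero_of_notMem_tsupport fun h' => hz (hgs h')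
      rw [this, zero_smul, inner_zero_right]
  have hae := hU.ae_eq_zero_of_integral_contDiff_smul_eq_zero hfli hzero
  rw [ae_restrict_iff' (measurableSet_Ioo.prod MeasurableSet.univ)]
  filter_upwards [hae] with z hz hzU
  have := hz hzU
  simp only [hf, sub_eq_zero] at this
  exact this

end Representation

end Literature.Analysis.FluidPDE

end
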